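import Literature.Claims.NS.ClayVariants
import Literature.Analysis.FluidPDE.ClassicalSolution
import Literature.Analysis.FluidPDE.ClassicalSolutionCalculus
import Literature.Analysis.FluidPDE.NSLerayHopf
import Literature.Analysis.FluidPDE.TaoLocalisation
import HarnessLib

/-!
# Claim skeleton: A. Tsionskiy & M. Tsionskiy (2025), «Existence, uniqueness and smoothness of a
# solution for 3D Navier–Stokes equations with any smooth initial velocity. A priori estimate of
# this solution»

Cell `ns-claims` (D-0090 NS-CLAIMS SWEEP), claim C15, typist `ns-claims-typist-12`.
UNREFEREED/DISPUTED CLAIM under adjudication — NOTHING in this file asserts a step: every `Step_k`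
is a `Prop` (the paper's k-th load-bearing assertion, typed concretely so that `¬ Step_k`, or its
vacuity, can be a kernel theorem in `Summits/…/Theorems/SoloRefuteTsionskiy2025.lean`); the only
`theorem`s are kernel COMPOSITIONS of the paper's own implications and small unfolding lemmas.

Version of record (lead RULING 2026-08-26T16:12Z): Int. J. Math. Anal. (Hikari) 19 (2025) no. 3,
117–149, doi:10.12988/ijma.2025.912568 [TsionskiyTsionskiy2025]; print page = PDF page + 116;
materialised `pub/ns-claims/sources/Tsionskiy2025/` (locators `LOCATORS.md`, ns-claims-lit-1). The
arXiv text 1403.3475 v15 (2022) [TsionskiyTsionskiy2014] carries §§6–8 word for word (v15 labels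
`eqn203t5`…`eqn203t3a` = (7.1)…(7.11), `thm31ym` = Thm 8.1; checked by the typist on the decisive
passage); v1 (2014) used a different decisive argument (a global contraction, its Thm 6.1) and is
NOT typed here (sub-row C15b if ever wanted; `sources/Tsionskiy2014/LOCATORS.md` §5, ns-claims-lit-4).

## Claimed statement (as printed)

Remark 8.3, p. 147: «From the above statements, it follows that there exists the unique set of
smooth functions u_∞i(x,t), p_∞(x,t) (i = 1, 2, 3) R³ × [0,∞) that satisfies (2.1), (2.2), (2.3) and
u_∞i, p_∞ ∈ C^∞(R³ × [0,∞)) (8.6). Then, using the inequality ‖u‖_{L₂} ≤ ‖u₀‖_{L₂} from [13], [12],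
we have ∫_{R³} |u_∞(x,t)|² dx < C ∀ t ≥ 0 (8.7). Let us consider ν → 0. Then we see that inequalities
(6.7), (6.46) are correct also in case of Euler equations; i.e., there exists unique smooth solution
in all time range for this case.» Setting (§2, p. 119–120): `ℝ³`, «ν is a positive coefficient of
the viscosity», data `u₀` a C^∞ divergence-free field with (2.5) = (2.11) «|∂^α u₀(x)| ≤ C_{αK}
(1+|x|)^{−K} on R^N for any α and any K» (= Fefferman's (4) token for token), force with (2.6), and
from §6 on «f ≡ 0» (p. 132). Typed: `ClaimedTheorem := ClayVariants.clayR3.Regularity ∧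
ClaimedUniqueness` (existence + (8.6) + (8.7) for every `ν > 0` IS Clay (A) over the landed schema
`Literature.Claims.NS.ClayVariants`; uniqueness is typed in the class the paper works in, velocity
slices in `→TS`); the Euler sentence is the separate Prop `ClaimedEuler` (TYPING-HYGIENE §5).

## Clay delta (reference `ClayVariants.lean`, axes Δ1–Δ8 of its §3)

Nearest: (A). `clay_of_claimed : ClaimedTheorem → clayR3.Regularity` is `And.left` — no delta on any
axis: Δ1 domain `ℝ³` = · Δ2 equations (1)–(3) = (2.1)–(2.3) = (the «ν → 0» Euler sentence is an
EXTRA claim, typed apart) · Δ3 force ≡ 0 (p. 132) = · Δ4 data class (2.5) = (4) = · Δ5 smooth on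
`ℝ³ × [0,∞)` + energy (8.7) = (6) + (7) = · Δ6 conclusion = existence (+ uniqueness, extra) · Δ7 every
`ν > 0` =. «Wrong problem» is therefore not available as a verdict for this claim.

## The paper's objects (pp. 120–143) and how they are typed

* `S` = Schwartz space on `ℝ³` (p. 120, «as in [7, 19]»), `→TS = S ⊕ S ⊕ S` (p. 120, no divergence
  condition). Typed by the tree's predicates: `InS φ := ContDiff ℝ ∞ φ ∧ HasRapidSpatialDecay φ`
  (scalar) and `InTS v` (vector) — literally the paper's description of `S` and its data class
  (2.5)/(2.11). Vector objects of `→TS` in §6 are typed as component families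
  `u : Fin 3 → (ℝ³ → ℝ)`; a field `v : ℝ³ → ℝ³` has components `comps v`.
* The norm (6.2) p. 132: `|·| ≡ ‖·‖₀`, i.e. (3.1) with `p = 0`, `‖φ‖₀ = sup_x |φ(x)|`, and (3.3)
  `‖φ⃗‖₀ = ∑_{i=1}^{3} ‖φᵢ‖₀` — the SUM of the component sup-norms: `supNorm`, `vecNorm`. (`⨆` over
  `ℝ³`; every input in the Steps below is a Schwartz function or the image of one under a bounded
  Fourier multiplier, so no junk value is in play — TYPING-HYGIENE §1 noted; the proved lemmas
  `abs_le_supNorm` / `supNorm_le` / `supNorm_nonneg` give the `∀ x`-renderings.)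
* Fourier transform (3.5)/(3.8)/(9.1) pp. 121–122, 147: `F[φ](γ) = (2π)^{−3/2} ∫ e^{+i(x,γ)} φ(x) dx`,
  `F⁻¹[ψ](x) = (2π)^{−3/2} ∫ e^{−i(x,γ)} ψ(γ) dγ`. With Mathlib's `𝓕 f (ξ) = ∫ e^{−2πi⟨x,ξ⟩} f(x) dx`,
  `𝓕⁻ g (x) = ∫ e^{+2πi⟨x,ξ⟩} g(ξ) dξ` one has EXACTLY `F⁻¹[m · F φ](x) = 𝓕⁻ (ξ ↦ m(−2πξ) · 𝓕 φ (ξ)) (x)`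
  (substitute `γ = −2πξ`; the factors `(2π)^{−3}` and `|dγ/dξ| = (2π)^3` cancel): this is `mulOp m φ`
  (real part taken; all the paper's multipliers are real and even, `m(−γ) = m(γ)`, so the output of
  a real input is real and `mulOp_eq_of_even` removes the sign).
* The cutoff (3.11)/(6.5) p. 122: `δ(γ) = exp(−ε³/(γ₁²+γ₂²+γ₃²))`, «0 < ε ≪ 1. For example ε = e^{−q₁},
  q₁ = 2, 3, 4, …», value `0` at `γ = 0` by (3.12): `cutoff ε`. The constant `ε` is FIXED once (it
  does not depend on `u`, `t`, `ν`, `δt`); «for example e^{−q}, q ≥ 2» is typed throughout as the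
  admissible range `0 < ε ≤ e^{−2}`, and likewise `0 < δt ≤ e^{−2}` for (7.2) «0 < Δt < δt ≪ 1. For
  example δt = e^{−q₃}, q₃ = 2, 3, 4, …» (the pre-fixed `Δt` only serves the continuation, Step 12).
* Operators: `B = F⁻¹[e^{−ν|γ|²t} δ(γ) F ·]` (6.4)/(6.6)–(6.7) p. 133: `opB`; `E = F⁻¹[(1 − δ(γ)) F ·]`
  (6.18)/(6.20)–(6.21) p. 135–136: `opE`; `S_ij(f_j) = ∫₀ᵗ F⁻¹[χ_ij(γ) e^{−ν|γ|²(t−τ)} δ(γ) F f_j(τ)] dτ`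
  (6.34)–(6.35) p. 138 with `χ_ij` the Leray multipliers of (4.29)–(4.35)/(6.36) (`δ_ij − γ_iγ_j/|γ|²`;
  (6.36) lists the off-diagonal fractions unsigned, the signs are those of (4.32)–(4.35); immaterial
  for the norm bounds): `opS`; and `Sᵗ_ij(f_j) = F⁻¹[χ_ij e^{−ν|γ|²(t−t*)} δ F f_j(t*)]` (6.41)/(6.45)–(6.46)
  p. 140–141: `opSt`. The matrix operators `B̿`, `E̿` act componentwise (6.3)/(6.17), `S̿`, `S̿ᵗ`
  entrywise with the sum over `j` (4.35)–(4.39).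
* The integral equation (6.1) p. 132 (= (5.2) with `f ≡ 0`; (8.1) p. 145 on `[0, δt]`):
  `u⃗ = −S̿·(u⃗·∇)u⃗ + E̿·u⃗ + B̿·u⃗₀`, componentwise at time `t`: `IntegralEqAt`; «`u⃗ ∈ →TS` continuous for
  `t` … solution of integral equation» (p. 132, p. 145): `IsIntegralSolutionOn`.
* Viscosity: every Step quantifies `0 ≤ ν`. `ν > 0` is the paper's standing case (§2); `ν = 0` is
  included because p. 147 asserts «inequalities (6.7), (6.46) are correct also in case of Euler
  equations; i.e., there exists unique smooth solution in all time range for this case» — the same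
  chain is claimed at `ν = 0` (`ClaimedEuler`, `euler_of_steps`). A refutation instance at some
  `ν > 0` (or a `ν`-free one, e.g. for `E`) hits the Navier–Stokes claim; one at `ν = 0` only would
  hit the Euler sentence only.

## Steps (paper item · print page · typist's private flag), ordered index (TYPING-HYGIENE 11)

Step 1 = `Step_1` (§5 «Equivalence of the Cauchy problem in differential form and in integral
form», pp. 131–132, with `f ≡ 0` = (6.1) p. 132; used on `[0, δt]` on p. 146) — plausible modulo
regularity bookkeeping · Step 2 = `Step_2` (Thm 6.1, (6.16) p. 135; scalar (6.15) = support decl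
`Eq615`) — suspicious (the kernel of `B` has zero mean since `δ(0) = 0`) · Step 3 = `Step_3`
(Thm 6.2, (6.33) p. 138; scalar (6.32) = `Eq632`) — suspicious (`1 − δ → 1` as `γ → 0`; (6.31)
bounds the low-frequency block by the volume `(2ε)³`) · Step 4 = `Step_4` ((6.39)–(6.41) pp. 139–140:
`S̿ = t·S̿ᵗ` with ONE intermediate time `t* ∈ (0, t)`, the form consumed by (7.5) and (8.1); abstract
inference = `Rule_uniformMeanValue`) — suspicious (a mean-value time uniform in `x`, `i`, `j`) ·
Step 5 = `Step_5` (Thm 6.3, (6.59) p. 143 for the matrix operator `S̿ᵗ` on `→TS`; scalar diagonal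
(6.58) = `Eq658`) — suspicious (same mechanism as Step 2, plus the Leray multipliers) · Step 6 =
`Step_6` ((7.5)–(7.7) p. 144: the three operator bounds applied to (8.1) at `t = δt`) — follows from
Steps 2–5 by the triangle inequality (7.6) if those hold · Step 7 = `Step_7` ((7.8) → (7.9) p. 144,
under (7.2)–(7.4): «we neglect small terms of the second order δt|δ(u⃗·∇)u⃗| and ε|δu⃗|»; abstract
inference = `Rule_neglect`) — suspicious (LOGIC) · Step 8 = `Step_8` ((7.10) p. 145, with
`δt = δ̃t |u⃗₀| / |(u⃗₀·∇)u⃗₀|`, `δ̃t ≪ 1`) — IS Step 7 rewritten (`step8_of_step7`, proved) · Step 9 =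
`Step_9` ((7.11) p. 145 «|u⃗| ≤ |u⃗₀|», Remark 7.1 «this estimate is obtained under the conditions
(7.2)–(7.4)»; the typist's registered PREDICTION) — suspicious (obtained from (7.10) by «we neglect
terms of the order of smallness δ̃t|u⃗₀| and … ε|u⃗₀| as compared with |u⃗₀|», `Rule_neglect`) ·
Step 10 = `Step_10` (Thm 8.1 pp. 145–146: existence of a `→TS`-valued solution of (8.1) on `[0, δt]`
for EVERY `u⃗₀ ∈ →TS`, one fixed `δt`; printed proof = invariance of `→TS` under the right-hand side of
(8.2), «it is evident that a solution … is u⃗ ∈ →TS») — suspicious (no fixed-point / compactness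
argument; the conclusion «`u⃗(t) ∈ →TS`» is itself in doubt for generic Schwartz data) · Step 11 =
`Step_11` (Thm 8.2 p. 146: uniqueness in `→TS` on `[0, δt]`; printed proof = «repeat the calculation
(7.1)–(7.11)» for `Δu⃗ = u⃗ − u⃗′` with `Δu⃗₀ = 0`, (8.4) `|Δu⃗| ≤ |Δu⃗₀| = 0`) — true as a STATEMENT
(classical local uniqueness), printed proof rests on Step 9 whose hypotheses (7.3)–(7.4) read
`|δ(Δu⃗)| ≪ |Δu⃗₀| = 0` for the difference (vacuity note, ref-4) · Step 12 = `Step_12` (IMPLICIT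
continuation, p. 146 l. −5 – p. 147 l. 3: «repeating the arguments … (7.1)–(8.5) with initial time
t = δt instead of t = 0 and the initial velocity u⃗|_{t=δt} instead of u⃗₀ … These arguments … can be
repeated arbitrarily long. Availability Δt leads to the fact that the process … continue for t → ∞»)
— true as typed (gluing of classical solutions over steps of one fixed length, junction smoothness
from the equation; unprinted) · Step 13 = `Step_13` (p. 147: «using the inequality ‖u⃗‖_{L₂} ≤ ‖u⃗₀‖_{L₂}
from [13], [12]» = Ladyzhenskaya 1969 / Kiselev–Ladyzhenskaya 1957 ⇒ (8.7)) — classical (energy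
inequality for smooth solutions with Schwartz slices).

Abstract-grain companions (TYPING-HYGIENE 13, FAILURE-MODES F15; not consumed by `claim_of_steps`):
`Step_2Abs` ((6.11)–(6.15) pp. 134–135: «continuous even multiplier with 0 ≤ A < 1 ⇒ strict sup-norm
contraction on S» — the inference shared by Thms 6.1 and 6.3; support `Eq614`, `Eq657` = the printed
(true) properties of the concrete multipliers; glue `eq615_of_step2Abs`, `eq658_of_step2Abs` proved) ·
`Step_3Abs` ((6.25)–(6.32) pp. 137–138: the same with `0 < A ≤ 1`, `A ≤ ε` off the ball `|γ| < ε` ⇒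
constant `ε`; support `Eq628`; glue `eq632_of_step3Abs` proved) · `Step_4Abs` = `Rule_uniformMeanValue`
((6.35) ⇒ (6.39)–(6.41)) · `Step_7Abs` = `Step_9Abs` = `Rule_neglect` ((7.8) ⇒ (7.9), (7.10) ⇒ (7.11)).

## COMPOSITION — proved as `claim_of_steps`

* `claim_of_steps : Step_1 → … → Step_13 → ClaimedTheorem` — PROVED (a few lines of logic + the
  tree's bridge `isNavierStokesSolution_and_smooth_iff` + finiteness of `∫|u⃗₀|²` for Clay data,
  `HasRapidSpatialDecay.lintegral_enorm_iteratedFDeriv_sq_lt_top`). The kernel composition CONSUMES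
  Steps 1, 10, 11, 12, 13 only (`localCauchy_of_steps : Step_1 → Step_10 → Step_11 → …` assembles the
  local Cauchy theory in `→TS` on `[0, δt]`, Step 12 globalises it, Step 13 gives (8.7)): Remark 8.3
  follows from the STATEMENTS of Thms 8.1/8.2, §5 and the continuation paragraph. Steps 2–9 (the
  operator bounds of §6 and the a-priori estimate of §7 — the «A priori estimate of this solution»
  of the title) are the paper's printed SUPPORT: (7.7) consumes (6.16), (6.33), (6.59) (p. 144,
  verbatim «Using inequalities (6.59) for operator S̿_δt, (6.33) for operator E̿ and (6.16) for
  operator B̿»); (7.11) is consumed by the proof of Thm 8.2 ((8.4), p. 146) and by Remark 7.1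
  («velocity decreases monotonically over time»); §8's preamble (p. 145) re-asserts «Operators S̿ᵗ, E̿
  and B̿ are bounded for vector-functions of the space →TS» before Thm 8.1. In the paper's own
  dependency order they come first, which is why they are Steps 2–9 of the index; a refuter who
  lands `¬ Step_2` / `¬ Step_3` reports, per MAP-SCHEMA §1b, which load-bearing decl's printed proof
  rests on it (Step 9 via (7.7); Step 11 via (8.4); Step 10 via the §8 preamble).
* `euler_of_steps : Step_1 → Step_10 → Step_11 → Step_12 → ClaimedEuler` — PROVED (the `ν = 0`
  instances of the same statements; p. 147).
* `step8_of_step7 : Step_7 → Step_8` — PROVED ((7.9) ⇒ (7.10) is algebra). NOT derivable as typed,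
  and not bridged: `Step_6 → Step_7` ((7.8) → (7.9), p. 144) and `Step_8 → Step_9` ((7.10) → (7.11),
  p. 145) — both are instances of `Rule_neglect`; `Step_9 → Step_11` ((8.4), p. 146: the difference
  of two solutions of (8.1) does not solve (8.1), and (7.3)–(7.4) for `Δu⃗₀ = 0` are unsatisfiable
  unless `Δu⃗ ≡ 0`). These are the BREAKS-AT-LOGIC candidates if the Steps themselves survive.

Design notes. Physical space is `EuclideanSpace ℝ (Fin 3)` spelled out (no notation, no instance);
solutions are the tree's `IsClassicalNSSolutionOn S ν 0 u p`; Clay (A) is cited through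
`ClayVariants.clayR3` (never restated); `(u⃗·∇)u⃗` is the tree's `convect`. The strict inequalities
(6.16)/(6.33)/(6.59) carry the hypothesis «`u ≠ 0`» (the only charity they need). (7.3) is typed at
`t = δt` («u⃗ = u⃗₀ + δu⃗» at «the moment t = δt»), (7.4) for all `τ ∈ [0, δt]` (the charitable reading
that covers the intermediate time `t*` of (6.39) at which `S̿^{δt}` evaluates the nonlinearity; the
print has no time argument there — ref-4 16:25Z note (3)); «≪» with the paper's example constants
`e^{−q}, q ≥ 2` is typed as `≤ e^{−2} · (…)`. The pressure «p ∈ S», «∇p ∈ →TS» (pp. 131, 146) is not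
typed (only smoothness of `p` enters (8.6)); «laminar/turbulent» (p. 147) is a remark, not a claim.

WHAT THIS IS NOT: not a claim about NS regularity or blow-up; not a claim about any author beyond the
typed locator.
-/

open MeasureTheory Set Filter Real
open scoped ContDiff ENNReal NNReal Topology FourierTransform

namespace Literature.Claims.NS.Tsionskiy2025

open Literature.Analysis.FluidPDE

noncomputable section

/-! ## Vocabulary (definitions with bodies; nothing asserted) -/

/-- `φ ∈ S` (p. 120: «the space S (Schwartz) of all infinitely differentiable functions … that …
tend to 0 as |x| → ∞, as well as their derivatives of any order, more rapidly than any power of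
1/|x|»), typed by the tree's predicates: smooth with Fefferman-(4) decay of every derivative.
[cite: TsionskiyTsionskiy2025, §3 p. 120] -/
def InS (φ : EuclideanSpace ℝ (Fin 3) → ℝ) : Prop :=
  ContDiff ℝ ∞ φ ∧ HasRapidSpatialDecay φ

/-- `v⃗ ∈ →TS = S ⊕ S ⊕ S` (p. 120; no divergence condition), for a field `v⃗ : ℝ³ → ℝ³`: smooth with
rapid decay of every derivative (equivalently, every component is in `S`); this is also the data
class (2.5)/(2.11) p. 119–120. [cite: TsionskiyTsionskiy2025, §3 p. 120, (2.5) p. 119] -/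
def InTS (v : EuclideanSpace ℝ (Fin 3) → EuclideanSpace ℝ (Fin 3)) : Prop :=
  ContDiff ℝ ∞ v ∧ HasRapidSpatialDecay v

/-- The components `vᵢ`, `i = 1, 2, 3`, of a field `v⃗ : ℝ³ → ℝ³`, as a family of scalar functions
(the paper's `→TS = S ⊕ S ⊕ S` bookkeeping, p. 120). [cite: TsionskiyTsionskiy2025, §3 p. 120] -/
def comps (v : EuclideanSpace ℝ (Fin 3) → EuclideanSpace ℝ (Fin 3)) :
    Fin 3 → EuclideanSpace ℝ (Fin 3) → ℝ :=
  fun i x => v x i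

/-- `‖φ‖₀ = sup_x |φ(x)|`: the norm (3.1) with `p = 0`, the «null norm» (6.2) p. 132 used throughout
§§6–8. (`⨆`; inputs below are bounded functions.) [cite: TsionskiyTsionskiy2025, (3.1) p. 120, (6.2) p. 132] -/
def supNorm (w : EuclideanSpace ℝ (Fin 3) → ℝ) : ℝ :=
  ⨆ x, |w x|

/-- `‖φ⃗‖₀ = ∑_{i=1}^{3} ‖φᵢ‖₀` (3.3) with `p = 0`: the SUM of the component sup-norms (not the sup of
the Euclidean length). [cite: TsionskiyTsionskiy2025, (3.3) p. 120, (6.2) p. 132] -/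
def vecNorm (v : Fin 3 → EuclideanSpace ℝ (Fin 3) → ℝ) : ℝ :=
  ∑ i, supNorm (v i)

/-- Junk-free reading aid for the norm (3.1)/(6.2): a bounded `|w|` is pointwise below `supNorm w`.
[cite: TsionskiyTsionskiy2025, (3.1) p. 120, (6.2) p. 132] -/
theorem abs_le_supNorm {w : EuclideanSpace ℝ (Fin 3) → ℝ}
    (hw : BddAbove (Set.range fun x => |w x|)) (x : EuclideanSpace ℝ (Fin 3)) :
    |w x| ≤ supNorm w :=
  le_ciSup hw x

/-- Junk-free reading aid for the norm (3.1)/(6.2): a pointwise bound is a bound on `supNorm`.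
[cite: TsionskiyTsionskiy2025, (3.1) p. 120, (6.2) p. 132] -/
theorem supNorm_le {w : EuclideanSpace ℝ (Fin 3) → ℝ} {M : ℝ} (h : ∀ x, |w x| ≤ M) :
    supNorm w ≤ M :=
  ciSup_le h

/-- The norm (3.1)/(6.2) is nonnegative: `supNorm w ≥ 0` (also when `|w|` is unbounded, where `⨆` is
the junk value `0`). [cite: TsionskiyTsionskiy2025, (3.1) p. 120, (6.2) p. 132] -/
theorem supNorm_nonneg (w : EuclideanSpace ℝ (Fin 3) → ℝ) : 0 ≤ supNorm w :=
  Real.iSup_nonneg fun x => abs_nonneg (w x)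

/-- The cutoff (3.11) p. 122 (copied as (6.5), (6.19), (6.38), (6.44)):
`δ(γ₁,γ₂,γ₃) = exp(−ε³/(γ₁²+γ₂²+γ₃²))`, `0 < ε ≪ 1`, extended by its limit `0` at `γ = 0` ((3.12)).
[cite: TsionskiyTsionskiy2025, (3.11)–(3.12) p. 122] -/
def cutoff (ε : ℝ) (γ : EuclideanSpace ℝ (Fin 3)) : ℝ :=
  if γ = 0 then 0 else Real.exp (-(ε ^ 3) / ‖γ‖ ^ 2)

/-- The multiplier of `B` (6.7) p. 133: `A = e^{−ν(γ₁²+γ₂²+γ₃²)t} · δ(γ)`.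
[cite: TsionskiyTsionskiy2025, (6.7) p. 133] -/
def symbB (ν t ε : ℝ) (γ : EuclideanSpace ℝ (Fin 3)) : ℝ :=
  Real.exp (-(ν * ‖γ‖ ^ 2 * t)) * cutoff ε γ

/-- The multiplier of `E` (6.21) p. 136: `A = 1 − δ(γ)`. [cite: TsionskiyTsionskiy2025, (6.21) p. 136] -/
def symbE (ε : ℝ) (γ : EuclideanSpace ℝ (Fin 3)) : ℝ :=
  1 - cutoff ε γ

/-- The Leray multipliers `χ_ij(γ)` of (4.29)–(4.35) p. 126–129 (listed in (6.36) p. 139):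
`χ_ii = (|γ|² − γᵢ²)/|γ|²`, `χ_ij = −γᵢγⱼ/|γ|²` (`i ≠ j`; the sign is the one of (4.32)–(4.35), (6.36)
prints the fractions unsigned — immaterial for norm bounds); value `δ_ij` at `γ = 0` (where the
cutoff vanishes anyway). [cite: TsionskiyTsionskiy2025, (4.29)–(4.35) pp. 126–129, (6.36) p. 139] -/
def leray (i j : Fin 3) (γ : EuclideanSpace ℝ (Fin 3)) : ℝ :=
  (if i = j then 1 else 0) - (if γ = 0 then 0 else γ i * γ j / ‖γ‖ ^ 2)

/-- The multiplier of the entry `S_ij` at time lag `s` ((6.35) p. 138 with `s = t − τ`; (6.46) p. 141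
with `s = t − t*`): `A_ij = χ_ij(γ) e^{−ν|γ|² s} δ(γ)`. [cite: TsionskiyTsionskiy2025, (6.35) p. 138, (6.46) p. 141] -/
def symbS (ν s ε : ℝ) (i j : Fin 3) (γ : EuclideanSpace ℝ (Fin 3)) : ℝ :=
  leray i j γ * Real.exp (-(ν * ‖γ‖ ^ 2 * s)) * cutoff ε γ

/-- The paper's Fourier-multiplier operator `φ ↦ F⁻¹[m · F[φ]]` ((6.6), (6.20), (6.45)) in the paper's
conventions (3.5)/(3.8)/(9.1), rendered EXACTLY in Mathlib's: `F⁻¹[m F φ](x) = 𝓕⁻(ξ ↦ m(−2πξ)·𝓕φ(ξ))(x)`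
(module docstring). Real part taken (real even multipliers map real functions to real functions).
[cite: TsionskiyTsionskiy2025, (3.5) p. 121, (3.8) p. 122, (9.1) p. 147] -/
def mulOp (m : EuclideanSpace ℝ (Fin 3) → ℝ) (φ : EuclideanSpace ℝ (Fin 3) → ℝ)
    (x : EuclideanSpace ℝ (Fin 3)) : ℝ :=
  (𝓕⁻ (fun ξ : EuclideanSpace ℝ (Fin 3) =>
      ((m (-((2 * π) • ξ)) : ℝ) : ℂ) * 𝓕 (fun y : EuclideanSpace ℝ (Fin 3) => ((φ y : ℝ) : ℂ)) ξ) x).re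

/-- For an EVEN multiplier (all of the paper's are: (6.8), (6.22), (6.47) «even function of the
coordinates») the sign in `m(−2πξ)` can be dropped. [cite: TsionskiyTsionskiy2025, (6.8) p. 134, (6.22) p. 136, (6.47) p. 141] -/
theorem mulOp_eq_of_even {m : EuclideanSpace ℝ (Fin 3) → ℝ} (hm : ∀ γ, m (-γ) = m γ)
    (φ : EuclideanSpace ℝ (Fin 3) → ℝ) (x : EuclideanSpace ℝ (Fin 3)) :
    mulOp m φ x =
      (𝓕⁻ (fun ξ : EuclideanSpace ℝ (Fin 3) =>
        ((m ((2 * π) • ξ) : ℝ) : ℂ) * 𝓕 (fun y : EuclideanSpace ℝ (Fin 3) => ((φ y : ℝ) : ℂ)) ξ) x).re := by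
  simp only [mulOp, hm]

/-- The operator `B` of (6.4)/(6.6)–(6.7) p. 133 on a scalar `u⁰ᵢ ∈ S` (time `t`, viscosity `ν`,
cutoff constant `ε`); `B̿ = diag(B, B, B)` (6.3). [cite: TsionskiyTsionskiy2025, (6.4)–(6.7) p. 133] -/
def opB (ν t ε : ℝ) (φ : EuclideanSpace ℝ (Fin 3) → ℝ) : EuclideanSpace ℝ (Fin 3) → ℝ :=
  mulOp (symbB ν t ε) φ

/-- The operator `E` of (6.18)/(6.20)–(6.21) pp. 135–136 on a scalar `uᵢ ∈ S`; `E̿ = diag(E, E, E)`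
(6.17). [cite: TsionskiyTsionskiy2025, (6.18)–(6.21) pp. 135–136] -/
def opE (ε : ℝ) (φ : EuclideanSpace ℝ (Fin 3) → ℝ) : EuclideanSpace ℝ (Fin 3) → ℝ :=
  mulOp (symbE ε) φ

/-- The matrix operator `S̿ᵗ` of (6.40)–(6.41) p. 140 / (6.45)–(6.46) p. 141 applied to `f⃗ ∈ →TS`
(component family): `(S̿ᵗ f⃗)_i = ∑_j F⁻¹[χ_ij e^{−ν|γ|²(t−t*)} δ F f_j]`, intermediate time `t*`.
[cite: TsionskiyTsionskiy2025, (6.40)–(6.41) p. 140, (6.45)–(6.46) p. 141] -/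
def opSt (ν t tstar ε : ℝ) (f : Fin 3 → EuclideanSpace ℝ (Fin 3) → ℝ) :
    Fin 3 → EuclideanSpace ℝ (Fin 3) → ℝ :=
  fun i x => ∑ j, mulOp (symbS ν (t - tstar) ε i j) (f j) x

/-- The matrix operator `S̿` of (6.34)–(6.35) p. 138 (Duhamel form, from (4.29)–(4.39)) applied to a
time-dependent `f⃗(τ) ∈ →TS`: `(S̿ f⃗)_i(x, t) = ∑_j ∫₀ᵗ F⁻¹[χ_ij e^{−ν|γ|²(t−τ)} δ F f_j(τ)](x) dτ`.
(Interval integral in `τ`; for the jointly continuous `→TS`-valued `f⃗` of Steps 4 and 6–11 the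
integrand is bounded and continuous in `τ`, as the paper assumes on p. 132 («Integral-operators
S_ij·(u⃗·∇)u⃗ … are continuous for t»), so no integrability side condition is carried —
TYPING-HYGIENE §2.) [cite: TsionskiyTsionskiy2025, (6.34)–(6.35) p. 138] -/
def opS (ν t ε : ℝ) (f : ℝ → Fin 3 → EuclideanSpace ℝ (Fin 3) → ℝ) :
    Fin 3 → EuclideanSpace ℝ (Fin 3) → ℝ :=
  fun i x => ∑ j, ∫ τ in (0 : ℝ)..t, mulOp (symbS ν (t - τ) ε i j) (f τ j) x

/-- The nonlinearity `f⃗ = (u⃗·∇)u⃗`, `f_j = ∑_n u_n ∂u_j/∂x_n` ((2.13)–(2.14) p. 120, (6.37) p. 139), as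
a component family; the tree's `convect`. [cite: TsionskiyTsionskiy2025, (6.37) p. 139] -/
def nonlin (v : EuclideanSpace ℝ (Fin 3) → EuclideanSpace ℝ (Fin 3)) :
    Fin 3 → EuclideanSpace ℝ (Fin 3) → ℝ :=
  fun j x => (convect v v x) j

/-- The integral equation (6.1) p. 132 (= (5.2) p. 132 with `f⃗ ≡ 0`; = (8.1) p. 145 on `[0, δt]`) AT
TIME `t`, componentwise: `uᵢ(t) = −(S̿·(u⃗·∇)u⃗)ᵢ(t) + E(uᵢ(t)) + B(u⁰ᵢ)`.
[cite: TsionskiyTsionskiy2025, (6.1) p. 132, (8.1) p. 145] -/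
def IntegralEqAt (ν ε : ℝ) (u₀ : EuclideanSpace ℝ (Fin 3) → EuclideanSpace ℝ (Fin 3))
    (u : ℝ → EuclideanSpace ℝ (Fin 3) → EuclideanSpace ℝ (Fin 3)) (t : ℝ) : Prop :=
  ∀ (x : EuclideanSpace ℝ (Fin 3)) (i : Fin 3),
    u t x i = -(opS ν t ε (fun τ => nonlin (u τ)) i x) + opE ε (comps (u t) i) x + opB ν t ε (comps u₀ i) x

/-- «`u⃗(x,t) ∈ →TS` continuous for `t` … solution of integral equation» (p. 132; p. 145 «Here
`u⃗ ∈ →TS`, `(u⃗·∇)u⃗ ∈ →TS`, …») on the time interval `[0, T]`, from the datum `u⃗₀`: every time slice in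
`→TS`, joint continuity, and (6.1)/(8.1) at every `t ∈ [0, T]`.
[cite: TsionskiyTsionskiy2025, §5 p. 132, (8.1) p. 145] -/
def IsIntegralSolutionOn (ν ε T : ℝ) (u₀ : EuclideanSpace ℝ (Fin 3) → EuclideanSpace ℝ (Fin 3))
    (u : ℝ → EuclideanSpace ℝ (Fin 3) → EuclideanSpace ℝ (Fin 3)) : Prop :=
  (∀ t ∈ Icc 0 T, InTS (u t)) ∧
    ContinuousOn (Function.uncurry u) (Icc 0 T ×ˢ univ) ∧
    ∀ t ∈ Icc 0 T, IntegralEqAt ν ε u₀ u t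

/-- Hypothesis (7.3) p. 144 at «the moment `t = δt`»: `u⃗ = u⃗₀ + δu⃗`, `|δu⃗| ≪ |u⃗₀|`, «For example
|δu⃗| = e^{−q₄}|u⃗₀|, q₄ = 2, 3, 4, …» — typed `|u⃗(δt) − u⃗₀| ≤ e^{−2} |u⃗₀|`.
[cite: TsionskiyTsionskiy2025, (7.3) p. 144] -/
def Hyp73 (u₀ : EuclideanSpace ℝ (Fin 3) → EuclideanSpace ℝ (Fin 3))
    (u : ℝ → EuclideanSpace ℝ (Fin 3) → EuclideanSpace ℝ (Fin 3)) (δt : ℝ) : Prop :=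
  vecNorm (comps fun x => u δt x - u₀ x) ≤ Real.exp (-2) * vecNorm (comps u₀)

/-- Hypothesis (7.4) p. 144: `(u⃗·∇)u⃗ = (u⃗₀·∇)u⃗₀ + δ(u⃗·∇)u⃗`, `|δ(u⃗·∇)u⃗| ≪ |(u⃗₀·∇)u⃗₀|`, «For example
… e^{−q₅} …, q₅ = 2, 3, 4, …» — typed for every time `τ ∈ [0, δt]` (charitable reading: the print
gives no time argument; this covers the intermediate time `t*` of (6.39) at which `S̿^{δt}` evaluates
the nonlinearity in (7.5)). [cite: TsionskiyTsionskiy2025, (7.4) p. 144] -/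
def Hyp74 (u₀ : EuclideanSpace ℝ (Fin 3) → EuclideanSpace ℝ (Fin 3))
    (u : ℝ → EuclideanSpace ℝ (Fin 3) → EuclideanSpace ℝ (Fin 3)) (δt : ℝ) : Prop :=
  ∀ τ ∈ Icc 0 δt,
    vecNorm (fun j x => nonlin (u τ) j x - nonlin u₀ j x) ≤ Real.exp (-2) * vecNorm (nonlin u₀)

/-- The LOCAL Cauchy problem in the paper's class (what Thm 8.1 + Thm 8.2 + §5 + «∇p … defined by
(2.1)», p. 146, deliver on one step): a classical solution `(u, p)` of the unforced system on
`ℝ³ × [0, T]` with `u(0) = w` and every velocity slice in `→TS`. [cite: TsionskiyTsionskiy2025, §8 pp. 145–146] -/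
def LocalSol (ν T : ℝ) (w : EuclideanSpace ℝ (Fin 3) → EuclideanSpace ℝ (Fin 3))
    (u : ℝ → EuclideanSpace ℝ (Fin 3) → EuclideanSpace ℝ (Fin 3))
    (p : ℝ → EuclideanSpace ℝ (Fin 3) → ℝ) : Prop :=
  IsClassicalNSSolutionOn (Icc 0 T) ν 0 u p ∧ u 0 = w ∧ ∀ t ∈ Icc 0 T, InTS (u t)

/-- The GLOBAL object of Remark 8.3 in the paper's class: a classical solution on `ℝ³ × [0, ∞)` with
`u(0) = w` and every velocity slice in `→TS`. [cite: TsionskiyTsionskiy2025, Remark 8.3 p. 147] -/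
def GlobalSol (ν : ℝ) (w : EuclideanSpace ℝ (Fin 3) → EuclideanSpace ℝ (Fin 3))
    (u : ℝ → EuclideanSpace ℝ (Fin 3) → EuclideanSpace ℝ (Fin 3))
    (p : ℝ → EuclideanSpace ℝ (Fin 3) → ℝ) : Prop :=
  IsClassicalNSSolutionOn (Ici 0) ν 0 u p ∧ u 0 = w ∧ ∀ t ∈ Ici 0, InTS (u t)

/-! ## The claimed statements -/

/-- **Uniqueness clause of Remark 8.3** (p. 147 «the unique set of smooth functions»), in the class
the paper works in (Thm 8.2: solutions «in the space →TS»): for `ν > 0` and a Clay datum, two smooth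
solutions of (2.1)–(2.3) (`f ≡ 0`) on `ℝ³ × [0,∞)` whose velocity slices are all rapidly decreasing
have the same velocity. (The pressure is «defined up to an arbitrary constant», p. 146 — not part
of the uniqueness typed.) [cite: TsionskiyTsionskiy2025, Remark 8.3 p. 147, Thm 8.2 p. 146] -/
def ClaimedUniqueness : Prop :=
  ∀ ν : ℝ, 0 < ν →
    ∀ u₀ : EuclideanSpace ℝ (Fin 3) → EuclideanSpace ℝ (Fin 3), ContDiff ℝ ∞ u₀ →
      NSWave0.IsDivFree u₀ → HasRapidSpatialDecay u₀ →
      ∀ (u u' : ℝ → EuclideanSpace ℝ (Fin 3) → EuclideanSpace ℝ (Fin 3))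
        (p p' : ℝ → EuclideanSpace ℝ (Fin 3) → ℝ),
        (IsSmoothOnHalfSpace u ∧ IsSmoothOnHalfSpace p ∧ IsNavierStokesSolution ν 0 u₀ u p ∧
            ∀ t : ℝ, 0 ≤ t → HasRapidSpatialDecay (u t)) →
        (IsSmoothOnHalfSpace u' ∧ IsSmoothOnHalfSpace p' ∧ IsNavierStokesSolution ν 0 u₀ u' p' ∧
            ∀ t : ℝ, 0 ≤ t → HasRapidSpatialDecay (u' t)) →
        ∀ t : ℝ, 0 ≤ t → u t = u' t

/-- **The claimed theorem, as printed** (Remark 8.3 (8.6)–(8.7) p. 147, with the setting of §2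
pp. 119–120 and «f ≡ 0» p. 132): for every `ν > 0` and every smooth divergence-free `u⃗₀` with (2.5)
there is a smooth solution of (2.1)–(2.3) on `ℝ³ × [0,∞)` with bounded energy (8.7) — token for token
Clay (A), cited as `ClayVariants.clayR3.Regularity` — and it is unique (`ClaimedUniqueness`).
[cite: TsionskiyTsionskiy2025, Remark 8.3 p. 147] -/
def ClaimedTheorem : Prop :=
  ClayVariants.clayR3.Regularity ∧ ClaimedUniqueness

/-- **The Euler sentence** (p. 147): «Let us consider ν → 0. Then we see that inequalities (6.7),
(6.46) are correct also in case of Euler equations; i.e., there exists unique smooth solution in all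
time range for this case»: global smooth existence for `ν = 0` from every Clay datum, and uniqueness
in the class of solutions with rapidly decreasing velocity slices. (No energy clause is printed for
this case; none is typed.) [cite: TsionskiyTsionskiy2025, Remark 8.3 p. 147] -/
def ClaimedEuler : Prop :=
  (∀ u₀ : EuclideanSpace ℝ (Fin 3) → EuclideanSpace ℝ (Fin 3), ContDiff ℝ ∞ u₀ →
      NSWave0.IsDivFree u₀ → HasRapidSpatialDecay u₀ →
      ∃ (u : ℝ → EuclideanSpace ℝ (Fin 3) → EuclideanSpace ℝ (Fin 3))
        (p : ℝ → EuclideanSpace ℝ (Fin 3) → ℝ),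
        IsSmoothOnHalfSpace u ∧ IsSmoothOnHalfSpace p ∧ IsNavierStokesSolution 0 0 u₀ u p) ∧
  (∀ u₀ : EuclideanSpace ℝ (Fin 3) → EuclideanSpace ℝ (Fin 3), ContDiff ℝ ∞ u₀ →
      NSWave0.IsDivFree u₀ → HasRapidSpatialDecay u₀ →
      ∀ (u u' : ℝ → EuclideanSpace ℝ (Fin 3) → EuclideanSpace ℝ (Fin 3))
        (p p' : ℝ → EuclideanSpace ℝ (Fin 3) → ℝ),
        (IsSmoothOnHalfSpace u ∧ IsSmoothOnHalfSpace p ∧ IsNavierStokesSolution 0 0 u₀ u p ∧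
            ∀ t : ℝ, 0 ≤ t → HasRapidSpatialDecay (u t)) →
        (IsSmoothOnHalfSpace u' ∧ IsSmoothOnHalfSpace p' ∧ IsNavierStokesSolution 0 0 u₀ u' p' ∧
            ∀ t : ℝ, 0 ≤ t → HasRapidSpatialDecay (u' t)) →
        ∀ t : ℝ, 0 ≤ t → u t = u' t)

/-- The claimed theorem implies Clay (A) (its first conjunct; no delta on any axis Δ1–Δ8; summit-side
`clayR3.Regularity ↔ NavierStokesRegularity` is `Iff.rfl`). [cite: TsionskiyTsionskiy2025, Remark 8.3 p. 147] -/
theorem clay_of_claimed (h : ClaimedTheorem) : ClayVariants.clayR3.Regularity :=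
  h.1

/-! ## The steps -/

/-- **Step 1 — §5 «Equivalence of the Cauchy problem in differential form (2.1)–(2.3) and in integral
form» (pp. 131–132), with `f⃗ ≡ 0` (= (6.1) p. 132).** «solving the Cauchy problem (2.1)–(2.3) is
equivalent to finding continuous in t … solution of integral equation (5.2)» (p. 132); the paper uses
it on `[0, δt]` (p. 146: «Then vector-function ∇p ∈ →TS is defined by (2.1) where vector-function u⃗ is
received from equation (8.1)») and on `[0, ∞)`. Typed on `[0, T]`, every `T > 0`, for a `→TS`-valued
jointly continuous `u⃗` from a divergence-free `u⃗₀ ∈ →TS`: `u⃗` is (the velocity of) a classical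
solution with `u⃗(0) = u⃗₀` IFF it satisfies (6.1) at every `t ∈ [0, T]` — for the paper's fixed cutoff
constant `ε` (any admissible one). Typist's flag: plausible modulo regularity bookkeeping (the
`⇒` direction is Duhamel's formula smeared by `δ` plus the remainder `E̿`; `⇐` includes smoothness in
`t` of a continuous `→TS`-valued solution and `u⃗(0) = u⃗₀`, (7.1)). [cite: TsionskiyTsionskiy2025, §5 pp. 131–132, (6.1) p. 132] -/
def Step_1 : Prop :=
  ∀ ν : ℝ, 0 ≤ ν → ∀ ε : ℝ, 0 < ε → ε ≤ Real.exp (-2) → ∀ T : ℝ, 0 < T →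
    ∀ u₀ : EuclideanSpace ℝ (Fin 3) → EuclideanSpace ℝ (Fin 3), InTS u₀ → NSWave0.IsDivFree u₀ →
    ∀ u : ℝ → EuclideanSpace ℝ (Fin 3) → EuclideanSpace ℝ (Fin 3),
      (∀ t ∈ Icc 0 T, InTS (u t)) → ContinuousOn (Function.uncurry u) (Icc 0 T ×ˢ univ) →
      ((∃ p : ℝ → EuclideanSpace ℝ (Fin 3) → ℝ, IsClassicalNSSolutionOn (Icc 0 T) ν 0 u p ∧ u 0 = u₀) ↔
        ∀ t ∈ Icc 0 T, IntegralEqAt ν ε u₀ u t)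

/-- Support decl for Step 2 — (6.15) p. 135, the scalar form: «|B(u⁰ᵢ)| < |u⁰ᵢ|, i = 1, 2, 3», for
every (nonzero) `u⁰ᵢ ∈ S`, every admissible `ν`, `t`, `ε`; printed inference p. 135: «We use the
formulas (6.12), (6.13) [the cases `A ≡ 1`, `A ≡ const`] and take the function A from formula
(6.14). Then in accordance with the rules of integration we obtain from formula (6.11) (6.15)».
[cite: TsionskiyTsionskiy2025, Thm 6.1 (6.15) p. 135] -/
def Eq615 : Prop :=
  ∀ ν : ℝ, 0 ≤ ν → ∀ ε : ℝ, 0 < ε → ε ≤ Real.exp (-2) → ∀ t : ℝ, 0 < t → t ≤ Real.exp (-2) →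
    ∀ φ : EuclideanSpace ℝ (Fin 3) → ℝ, InS φ → (∃ x, φ x ≠ 0) →
      supNorm (opB ν t ε φ) < supNorm φ

/-- **Step 2 — Theorem 6.1, (6.16) p. 135: «|B̿·u⃗₀| < |u⃗₀|, where u⃗₀ ∈ →TS».** For every admissible
viscosity, cutoff constant `ε ∈ (0, e^{−2}]` and time `t ∈ (0, e^{−2}]` (the theorem leaves `t` free;
it is consumed at `t = δt`, (7.7) p. 144) and every nonzero `u⃗₀ ∈ →TS`: the componentwise operator
`B̿ = diag(B,B,B)`, `B = F⁻¹[e^{−ν|γ|²t} δ(γ) F·]`, is a strict contraction in the norm (6.2). Consumed by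
(7.7) and by §8's preamble p. 145. Typist's flag: suspicious (`δ(0) = 0`, so the kernel of `B` has
zero mean; `‖B‖_{∞→∞} = ‖F⁻¹A‖_{L¹} ≈ 2` for small `t`). [cite: TsionskiyTsionskiy2025, Thm 6.1 (6.16) p. 135] -/
def Step_2 : Prop :=
  ∀ ν : ℝ, 0 ≤ ν → ∀ ε : ℝ, 0 < ε → ε ≤ Real.exp (-2) → ∀ t : ℝ, 0 < t → t ≤ Real.exp (-2) →
    ∀ u : Fin 3 → EuclideanSpace ℝ (Fin 3) → ℝ, (∀ i, InS (u i)) → (∃ i x, u i x ≠ 0) →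
      vecNorm (fun i => opB ν t ε (u i)) < vecNorm u

/-- Support decl for Step 3 — (6.32) p. 138, the scalar form: «|E(uᵢ)| < ε|uᵢ|, i = 1, 2, 3» for every
(nonzero) `uᵢ ∈ S`; printed inference (6.28)–(6.31) ⇒ (6.32): «I_{(2ε)³} ∼ (2ε)³, I_{R³−(2ε)³} ∼ ε …
Then in accordance with the rules of integration we obtain from formula (6.30) |E(uᵢ)| < ε|uᵢ|».
[cite: TsionskiyTsionskiy2025, Thm 6.2 (6.32) p. 138] -/
def Eq632 : Prop :=
  ∀ ε : ℝ, 0 < ε → ε ≤ Real.exp (-2) →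
    ∀ φ : EuclideanSpace ℝ (Fin 3) → ℝ, InS φ → (∃ x, φ x ≠ 0) →
      supNorm (opE ε φ) < ε * supNorm φ

/-- **Step 3 — Theorem 6.2, (6.33) p. 138: «|E̿·u⃗| < ε|u⃗|, where u⃗ ∈ →TS».** For the FIXED cutoff
constant `ε ∈ (0, e^{−2}]` of (3.11) and every nonzero `u⃗ ∈ →TS`: `E̿ = diag(E,E,E)`,
`E = F⁻¹[(1 − δ(γ)) F·]`, has norm `< ε` in the norm (6.2). Consumed by (7.7) p. 144 (the term `ε|u⃗|`).
Typist's flag: suspicious (`1 − δ(γ) → 1` as `γ → 0`: wide profiles are almost fixed by `E`).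
[cite: TsionskiyTsionskiy2025, Thm 6.2 (6.33) p. 138] -/
def Step_3 : Prop :=
  ∀ ε : ℝ, 0 < ε → ε ≤ Real.exp (-2) →
    ∀ u : Fin 3 → EuclideanSpace ℝ (Fin 3) → ℝ, (∀ i, InS (u i)) → (∃ i x, u i x ≠ 0) →
      vecNorm (fun i => opE ε (u i)) < ε * vecNorm u

/-- Support decl for Step 4 — the abstract inference behind (6.35) ⇒ (6.39)–(6.41): a mean-value
time `t*` for a parameter-dependent integral that is UNIFORM in the parameter («`S_ij(f_j) = t·Sᵗ_ij(f_j)`,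
`0 < t* < t`», then used for the whole matrix `S̿ᵗ` acting on the single time slice `f⃗(t*)`): for a
jointly continuous `G`, `∃ t* ∈ (0,t), ∀ x, ∫₀ᵗ G(τ, x) dτ = t · G(t*, x)`. Recorded (FAILURE-MODES F15)
so that the LOGIC class of Step 4 is kernel-checkable independently of any Fourier analysis; not
consumed by any composition. [cite: TsionskiyTsionskiy2025, (6.39) p. 139] -/
def Rule_uniformMeanValue : Prop :=
  ∀ t : ℝ, 0 < t → ∀ G : ℝ → EuclideanSpace ℝ (Fin 3) → ℝ,
    ContinuousOn (Function.uncurry G) (Icc 0 t ×ˢ univ) →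
      ∃ tstar : ℝ, 0 < tstar ∧ tstar < t ∧
        ∀ x : EuclideanSpace ℝ (Fin 3), ∫ τ in (0 : ℝ)..t, G τ x = t * G tstar x

/-- **Step 4 — (6.39)–(6.41) pp. 139–140: «S_ij(f_j) = t/(2π)^{3/2} ∫ χ_ij e^{−ν|γ|²(t−t*)} F_j(γ, t*) δ
e^{−i(x,γ)} dγ ≡ t Sᵗ_ij(f_j), 0 < t* < t», i.e. `S̿·f⃗ = t · S̿ᵗ·f⃗(t*)` with ONE intermediate time,** the
form consumed by (7.5) p. 144 («u⃗ = −δt S̿^{δt}·(u⃗·∇)u⃗ + …») and (8.1) p. 145. Typed for every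
`→TS`-valued jointly continuous `f⃗` on `[0, t]`, `t ∈ (0, e^{−2}]` («0 < Δt < δt ≪ 1. Therefore t ≪ 1»,
p. 139): there is `t* ∈ (0, t)` with `(S̿ f⃗)(x)_i = t · (S̿^{t,t*} f⃗(t*))(x)_i` for ALL `x` and `i`. (The
per-`(i, j, x)` version is the scalar mean-value theorem and does not give (6.40)/(8.1).) Typist's
flag: suspicious (`Rule_uniformMeanValue`). [cite: TsionskiyTsionskiy2025, (6.39)–(6.41) pp. 139–140] -/
def Step_4 : Prop :=
  ∀ ν : ℝ, 0 ≤ ν → ∀ ε : ℝ, 0 < ε → ε ≤ Real.exp (-2) → ∀ t : ℝ, 0 < t → t ≤ Real.exp (-2) →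
    ∀ f : ℝ → Fin 3 → EuclideanSpace ℝ (Fin 3) → ℝ,
      (∀ τ ∈ Icc 0 t, ∀ j, InS (f τ j)) →
      (∀ j, ContinuousOn (Function.uncurry fun τ x => f τ j x) (Icc 0 t ×ˢ univ)) →
      ∃ tstar : ℝ, 0 < tstar ∧ tstar < t ∧
        ∀ (i : Fin 3) (x : EuclideanSpace ℝ (Fin 3)), opS ν t ε f i x = t * opSt ν t tstar ε (f tstar) i x

/-- Support decl for Step 5 — (6.58) p. 143, the scalar diagonal form of Theorem 6.3: «|Sᵗ_ii(f_i)| <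
|f_i|, i = 1, 2, 3» for every (nonzero) `f_i ∈ S`, admissible `ν`, `ε`, `0 < t* < t ≤ e^{−2}`; printed
inference p. 143: «We use the formulas (6.55), (6.56) and take the function A_ii from formula (6.57).
Then in accordance with the rules of integration we obtain from formula (6.54) (6.58)».
[cite: TsionskiyTsionskiy2025, Thm 6.3 (6.58) p. 143] -/
def Eq658 : Prop :=
  ∀ ν : ℝ, 0 ≤ ν → ∀ ε : ℝ, 0 < ε → ε ≤ Real.exp (-2) → ∀ t : ℝ, 0 < t → t ≤ Real.exp (-2) →
    ∀ tstar : ℝ, 0 < tstar → tstar < t →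
    ∀ (i : Fin 3) (φ : EuclideanSpace ℝ (Fin 3) → ℝ), InS φ → (∃ x, φ x ≠ 0) →
      supNorm (mulOp (symbS ν (t - tstar) ε i i) φ) < supNorm φ

/-- **Step 5 — Theorem 6.3, (6.59) p. 143: «the matrix integral operator S̿ᵗ is bounded for
vector-functions of the space →TS and, using formula (6.43), we have |S̿ᵗ·(u⃗·∇)u⃗| < |(u⃗·∇)u⃗| (6.59),
where (u⃗·∇)u⃗ ∈ →TS»:** for admissible `ν`, `ε`, `0 < t* < t ≤ e^{−2}` and every nonzero `f⃗ ∈ →TS` (the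
paper displays the instance `f⃗ = (u⃗·∇)u⃗`, (6.43)), `|S̿ᵗ f⃗| < |f⃗|` in the norm (6.2). Consumed by (7.7)
p. 144 (the term `δt|(u⃗·∇)u⃗|`). Typist's flag: suspicious (zero-mean kernels as in Step 2, the Leray
multipliers `χ_ij`, and (6.58) entrywise would give the constant `3`, not `1`, for the matrix).
[cite: TsionskiyTsionskiy2025, Thm 6.3 (6.59) p. 143] -/
def Step_5 : Prop :=
  ∀ ν : ℝ, 0 ≤ ν → ∀ ε : ℝ, 0 < ε → ε ≤ Real.exp (-2) → ∀ t : ℝ, 0 < t → t ≤ Real.exp (-2) →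
    ∀ tstar : ℝ, 0 < tstar → tstar < t →
    ∀ f : Fin 3 → EuclideanSpace ℝ (Fin 3) → ℝ, (∀ j, InS (f j)) → (∃ j x, f j x ≠ 0) →
      vecNorm (opSt ν t tstar ε f) < vecNorm f

/-! ### Abstract grain of Theorems 6.1–6.3 (TYPING-HYGIENE 13 / FAILURE-MODES F15)

The three operator theorems are proved in print by ONE inference pattern, displayed at the level of
an arbitrary multiplier `A`: «In case if A ≡ 1 … B(u⁰ᵢ) ≡ u⁰ᵢ (6.12). If 0 < A < 1, A − const., it is
evident from the formula (6.11) that |B(u⁰ᵢ)| < |u⁰ᵢ| (6.13) … We use the formulas (6.12), (6.13) and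
take the function A from formula (6.14) [`0 ≤ A < 1`, continuous, even]. Then in accordance with the
rules of integration we obtain from formula (6.11) |B(u⁰ᵢ)| < |u⁰ᵢ| (6.15)» (p. 134–135; verbatim
again at (6.26)–(6.32) p. 137–138 with the extra frequency split (6.28)–(6.31), and at (6.55)–(6.58)
p. 143). The companions below type that inference AS PRINTED, quantified over the multiplier; the
printed properties (6.14), (6.22)+(6.28)–(6.29), (6.57) of the paper's three concrete multipliers
are the (true) support decls `Eq614`, `Eq628`, `Eq657`, and the paper's own reductions are the
proved glue `eq615_of_step2Abs`, `eq632_of_step3Abs`, `eq658_of_step2Abs`. Mapping for the bus: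
`Step_2Abs` (also the grain of Step 5), `Step_3Abs`; `Step_4Abs` = `Rule_uniformMeanValue`;
`Step_7Abs` = `Step_9Abs` = `Rule_neglect`. (`Step_2Abs` is, up to the rendering of `S` and the sign
convention of `mulOp`, ns-claims-ref-4's `MultiplierContraction_asPrinted`.) -/

/-- **Step 2Abs — the printed inference (6.11)–(6.15) p. 134–135 at the grain the proof uses it:**
every continuous, even Fourier multiplier `A` with `0 ≤ A(γ) < 1` for all `γ` is a STRICT contraction
of `S` in the sup-norm (6.2): `|F⁻¹[A·F[u]]| < |u|` for every nonzero `u ∈ S`. (The constant case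
(6.13) is true; the passage to a non-constant `A` «in accordance with the rules of integration» is the
inference.) Not consumed by `claim_of_steps`; `Eq614 → Step_2Abs → Eq615` and `Eq657 → Step_2Abs →
Eq658` are proved below. [cite: TsionskiyTsionskiy2025, (6.11)–(6.15) pp. 134–135] -/
def Step_2Abs : Prop :=
  ∀ m : EuclideanSpace ℝ (Fin 3) → ℝ, Continuous m → (∀ γ, m (-γ) = m γ) →
    (∀ γ, 0 ≤ m γ ∧ m γ < 1) →
    ∀ φ : EuclideanSpace ℝ (Fin 3) → ℝ, InS φ → (∃ x, φ x ≠ 0) →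
      supNorm (mulOp m φ) < supNorm φ

/-- Support decl — (6.8)/(6.14) p. 134–135, the printed properties of the multiplier of `B`: «The
function A of the formula (6.14) is a continuous, even function of the coordinates γ₁, γ₂, γ₃» and
«0 ≤ A = e^{−ν(γ₁²+γ₂²+γ₃²)t}·δ(γ₁,γ₂,γ₃) < 1 (6.14)» (true). [cite: TsionskiyTsionskiy2025, (6.8) p. 134, (6.14) p. 135] -/
def Eq614 : Prop :=
  ∀ ν : ℝ, 0 ≤ ν → ∀ ε : ℝ, 0 < ε → ε ≤ Real.exp (-2) → ∀ t : ℝ, 0 < t → t ≤ Real.exp (-2) →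
    Continuous (symbB ν t ε) ∧ (∀ γ, symbB ν t ε (-γ) = symbB ν t ε γ) ∧
      ∀ γ, 0 ≤ symbB ν t ε γ ∧ symbB ν t ε γ < 1

/-- The paper's own reduction of (6.15) to the abstract inference: (6.14) + `Step_2Abs` ⇒ (6.15)
(p. 135, pure logic). [cite: TsionskiyTsionskiy2025, (6.14)–(6.15) p. 135] -/
theorem eq615_of_step2Abs (h614 : Eq614) (h : Step_2Abs) : Eq615 := by
  intro ν hν ε hε hε' t ht ht' φ hφ hne
  obtain ⟨hc, hev, hb⟩ := h614 ν hν ε hε hε' t ht ht'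
  exact h _ hc hev hb φ hφ hne

/-- **Step 3Abs — the printed inference (6.25)–(6.32) p. 137–138 at the grain the proof uses it:**
for the cutoff constant `ε ∈ (0, e^{−2}]`, every continuous, even multiplier `A` with `0 < A ≤ 1`
(6.22) and `A(γ) ≤ ε` wherever `γ₁²+γ₂²+γ₃² ≥ ε²` (6.28) satisfies `|F⁻¹[A·F[u]]| < ε|u|` for every nonzero
`u ∈ S` («I_{(2ε)³} ∼ (2ε)³, I_{R³−(2ε)³} ∼ ε (6.31) … Then in accordance with the rules of integration
we obtain from formula (6.30) |E(uᵢ)| < ε|uᵢ| (6.32)»). Not consumed by `claim_of_steps`;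
`Eq628 → Step_3Abs → Eq632` is proved below. [cite: TsionskiyTsionskiy2025, (6.25)–(6.32) pp. 137–138] -/
def Step_3Abs : Prop :=
  ∀ ε : ℝ, 0 < ε → ε ≤ Real.exp (-2) →
    ∀ m : EuclideanSpace ℝ (Fin 3) → ℝ, Continuous m → (∀ γ, m (-γ) = m γ) →
      (∀ γ, 0 < m γ ∧ m γ ≤ 1) → (∀ γ, ε ^ 2 ≤ ‖γ‖ ^ 2 → m γ ≤ ε) →
      ∀ φ : EuclideanSpace ℝ (Fin 3) → ℝ, InS φ → (∃ x, φ x ≠ 0) →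
        supNorm (mulOp m φ) < ε * supNorm φ

/-- Support decl — (6.22) p. 136 and (6.28)–(6.29) p. 137, the printed properties of the multiplier of
`E`, `A = 1 − δ(γ)`: continuous, even, «0 < A ≤ 1 (6.22)», «0 < A ≤ ε (6.28) for (γ₁²+γ₂²+γ₃²) ≥ ε²»
(true: `1 − e^{−ε³/|γ|²} ≤ ε³/|γ|² ≤ ε` there). [cite: TsionskiyTsionskiy2025, (6.22) p. 136, (6.28)–(6.29) p. 137] -/
def Eq628 : Prop :=
  ∀ ε : ℝ, 0 < ε → ε ≤ Real.exp (-2) →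
    Continuous (symbE ε) ∧ (∀ γ, symbE ε (-γ) = symbE ε γ) ∧
      (∀ γ, 0 < symbE ε γ ∧ symbE ε γ ≤ 1) ∧ (∀ γ, ε ^ 2 ≤ ‖γ‖ ^ 2 → symbE ε γ ≤ ε)

/-- The paper's own reduction of (6.32) to the abstract inference: (6.22)+(6.28) + `Step_3Abs` ⇒
(6.32) (p. 138, pure logic). [cite: TsionskiyTsionskiy2025, (6.28)–(6.32) pp. 137–138] -/
theorem eq632_of_step3Abs (h628 : Eq628) (h : Step_3Abs) : Eq632 := by
  intro ε hε hε' φ hφ hne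
  obtain ⟨hc, hev, hb, hs⟩ := h628 ε hε hε'
  exact h ε hε hε' _ hc hev hb hs φ hφ hne

/-- Support decl — (6.47)/(6.57) p. 141–143, the printed properties of the diagonal multipliers of
`S̿ᵗ`: «The function A_ii of the formula (6.57) is a continuous, even function of the coordinates» and
«0 ≤ A_ii = χ_ii e^{−ν|γ|²(t−t*)}·δ(γ) < 1 (6.57)» (true). [cite: TsionskiyTsionskiy2025, (6.47) p. 141, (6.57) p. 143] -/
def Eq657 : Prop :=
  ∀ ν : ℝ, 0 ≤ ν → ∀ ε : ℝ, 0 < ε → ε ≤ Real.exp (-2) → ∀ t : ℝ, 0 < t → t ≤ Real.exp (-2) →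
    ∀ tstar : ℝ, 0 < tstar → tstar < t → ∀ i : Fin 3,
      Continuous (symbS ν (t - tstar) ε i i) ∧
        (∀ γ, symbS ν (t - tstar) ε i i (-γ) = symbS ν (t - tstar) ε i i γ) ∧
        ∀ γ, 0 ≤ symbS ν (t - tstar) ε i i γ ∧ symbS ν (t - tstar) ε i i γ < 1

/-- The paper's own reduction of (6.58) to the abstract inference: (6.57) + `Step_2Abs` ⇒ (6.58)
(p. 143, pure logic; the same inference as for Theorem 6.1). [cite: TsionskiyTsionskiy2025, (6.57)–(6.58) p. 143] -/
theorem eq658_of_step2Abs (h657 : Eq657) (h : Step_2Abs) : Eq658 := by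
  intro ν hν ε hε hε' t ht ht' tstar hts hts' i φ hφ hne
  obtain ⟨hc, hev, hb⟩ := h657 ν hν ε hε hε' t ht ht' tstar hts hts' i
  exact h _ hc hev hb φ hφ hne

/-- **Step 6 — (7.5)–(7.7) p. 144.** «We rewrite the equation (6.1) at the moment t = δt > 0:
u⃗ = −δt S̿^{δt}·(u⃗·∇)u⃗ + E̿·u⃗ + B̿·u⃗₀ (7.5) … |u⃗| ≤ |δt S̿^{δt}·(u⃗·∇)u⃗| + |E̿·u⃗| + |B̿·u⃗₀| (7.6). Using
inequalities (6.59) for operator S̿^{δt}, (6.33) for operator E̿ and (6.16) for operator B̿, we obtain: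
|u⃗| ≤ δt|(u⃗·∇)u⃗| + ε|u⃗| + |u⃗₀| (7.7)»: for every `→TS`-valued solution of (8.1) on `[0, δt]` from a
divergence-free `u⃗₀ ∈ →TS` there is an intermediate time `t* ∈ (0, δt)` (Step 4) with
`|u⃗(δt)| ≤ δt·|(u⃗·∇)u⃗(t*)| + ε·|u⃗(δt)| + |u⃗₀|`. The paper's consequence of Steps 2–5 and the triangle
inequality (7.6). Typist's flag: stands or falls with Steps 2–5. [cite: TsionskiyTsionskiy2025, (7.5)–(7.7) p. 144] -/
def Step_6 : Prop :=
  ∀ ν : ℝ, 0 ≤ ν → ∀ ε : ℝ, 0 < ε → ε ≤ Real.exp (-2) → ∀ δt : ℝ, 0 < δt → δt ≤ Real.exp (-2) →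
    ∀ u₀ : EuclideanSpace ℝ (Fin 3) → EuclideanSpace ℝ (Fin 3), InTS u₀ → NSWave0.IsDivFree u₀ →
    ∀ u : ℝ → EuclideanSpace ℝ (Fin 3) → EuclideanSpace ℝ (Fin 3), IsIntegralSolutionOn ν ε δt u₀ u →
      ∃ tstar : ℝ, 0 < tstar ∧ tstar < δt ∧
        vecNorm (comps (u δt)) ≤
          δt * vecNorm (nonlin (u tstar)) + ε * vecNorm (comps (u δt)) + vecNorm (comps u₀)

/-- Support decl for Steps 7 and 9 — the abstract inference «we neglect small terms … as compared
with …» ((7.8) → (7.9) p. 144; (7.10) → (7.11) p. 145) as a rule about real numbers: from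
`a ≤ b + s` with `0 ≤ s ≤ c·b`, `c ≤ 2e^{−2}` («≪»), conclude `a ≤ b`. Recorded (FAILURE-MODES F15) so
that the LOGIC class of those passages is kernel-checkable independently of any PDE content; not
consumed by any composition. [cite: TsionskiyTsionskiy2025, (7.9) p. 144, (7.11) p. 145] -/
def Rule_neglect : Prop :=
  ∀ a b s c : ℝ, 0 ≤ b → 0 ≤ c → c ≤ 2 * Real.exp (-2) → 0 ≤ s → s ≤ c * b → a ≤ b + s → a ≤ b

/-- **Step 7 — (7.8) → (7.9) p. 144.** Substituting (7.3), (7.4) into (7.7) gives (7.8)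
«|u⃗| ≤ δt|(u⃗₀·∇)u⃗₀| + δt|δ(u⃗·∇)u⃗| + ε|u⃗₀| + ε|δu⃗| + |u⃗₀|»; «As δt ≪ 1, ε ≪ 1 and |δ(u⃗·∇)u⃗| ≪
|(u⃗₀·∇)u⃗₀| …, |δu⃗| ≪ |u⃗₀| … we neglect small terms of the second order δt|δ(u⃗·∇)u⃗| and ε|δu⃗| and
obtain: |u⃗| ≤ δt|(u⃗₀·∇)u⃗₀| + ε|u⃗₀| + |u⃗₀| (7.9)». Typed: for every `→TS`-valued solution of (8.1) on
`[0, δt]` satisfying (7.2)–(7.4), the bound (7.9) at `t = δt`. Typist's flag: suspicious — as an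
inference from Step 6 it is `Rule_neglect`; as a statement about solutions it is a one-step
sup-norm bound with the fixed constant `ε`. [cite: TsionskiyTsionskiy2025, (7.8)–(7.9) p. 144] -/
def Step_7 : Prop :=
  ∀ ν : ℝ, 0 ≤ ν → ∀ ε : ℝ, 0 < ε → ε ≤ Real.exp (-2) → ∀ δt : ℝ, 0 < δt → δt ≤ Real.exp (-2) →
    ∀ u₀ : EuclideanSpace ℝ (Fin 3) → EuclideanSpace ℝ (Fin 3), InTS u₀ → NSWave0.IsDivFree u₀ →
    ∀ u : ℝ → EuclideanSpace ℝ (Fin 3) → EuclideanSpace ℝ (Fin 3), IsIntegralSolutionOn ν ε δt u₀ u →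
      Hyp73 u₀ u δt → Hyp74 u₀ u δt →
        vecNorm (comps (u δt)) ≤
          δt * vecNorm (nonlin u₀) + ε * vecNorm (comps u₀) + vecNorm (comps u₀)

/-- **Step 8 — (7.10) p. 145.** «Since u⃗₀ ∈ →TS and (u⃗₀·∇)u⃗₀ ∈ →TS then 0 < |u⃗₀| < C⁰ < ∞ and
0 < |(u⃗₀·∇)u⃗₀| < C^{∇0} < ∞ … We can introduce δ̃t ≪ 1, δt = δ̃t |u⃗₀| / |(u⃗₀·∇)u⃗₀| and we have from
formula (7.9): |u⃗| ≤ δ̃t|u⃗₀| + ε|u⃗₀| + |u⃗₀| = (δ̃t + ε + 1)|u⃗₀| (7.10)». Typed with `δ̃t ∈ (0, e^{−2}]` and the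
relation `δt·|(u⃗₀·∇)u⃗₀| = δ̃t·|u⃗₀|` as hypotheses. Typist's flag: IS Step 7 rewritten
(`step8_of_step7`). [cite: TsionskiyTsionskiy2025, (7.10) p. 145] -/
def Step_8 : Prop :=
  ∀ ν : ℝ, 0 ≤ ν → ∀ ε : ℝ, 0 < ε → ε ≤ Real.exp (-2) → ∀ δt : ℝ, 0 < δt → δt ≤ Real.exp (-2) →
    ∀ u₀ : EuclideanSpace ℝ (Fin 3) → EuclideanSpace ℝ (Fin 3), InTS u₀ → NSWave0.IsDivFree u₀ →
    ∀ u : ℝ → EuclideanSpace ℝ (Fin 3) → EuclideanSpace ℝ (Fin 3), IsIntegralSolutionOn ν ε δt u₀ u →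
      Hyp73 u₀ u δt → Hyp74 u₀ u δt →
      ∀ δtt : ℝ, 0 < δtt → δtt ≤ Real.exp (-2) →
        δt * vecNorm (nonlin u₀) = δtt * vecNorm (comps u₀) →
          vecNorm (comps (u δt)) ≤ (δtt + ε + 1) * vecNorm (comps u₀)

/-- **Step 9 — (7.11) p. 145, the a-priori estimate, with Remark 7.1.** «As δ̃t ≪ 1 and ε ≪ 1, we
neglect terms of the order of smallness δ̃t|u⃗₀| and terms of the order of smallness ε|u⃗₀| as compared
with |u⃗₀|. We have the evaluation for velocity u⃗ at time δt from the equation (7.10): |u⃗| ≤ |u⃗₀|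
(7.11)»; Remark 7.1: repeated on `[δt, 2δt], …` «arbitrarily long … the rate of velocity u⃗ decreases
monotonically over time. It should be noted that this estimate is obtained under the conditions
(7.2)–(7.4)». Typed with exactly the hypotheses of Step 8 (the standing conditions (7.2)–(7.4) and
the `δ̃t`-relation): the sup-norm (6.2) of the solution at `t = δt` does not exceed that of the datum.
This is the typist's registered PREDICTION (CARD §4). Typist's flag: suspicious — obtained from
(7.10) by `Rule_neglect`; consumed by Thm 8.2 (8.4) and Remark 7.1.
[cite: TsionskiyTsionskiy2025, (7.11) and Remark 7.1 p. 145] -/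
def Step_9 : Prop :=
  ∀ ν : ℝ, 0 ≤ ν → ∀ ε : ℝ, 0 < ε → ε ≤ Real.exp (-2) → ∀ δt : ℝ, 0 < δt → δt ≤ Real.exp (-2) →
    ∀ u₀ : EuclideanSpace ℝ (Fin 3) → EuclideanSpace ℝ (Fin 3), InTS u₀ → NSWave0.IsDivFree u₀ →
    ∀ u : ℝ → EuclideanSpace ℝ (Fin 3) → EuclideanSpace ℝ (Fin 3), IsIntegralSolutionOn ν ε δt u₀ u →
      Hyp73 u₀ u δt → Hyp74 u₀ u δt →
      ∀ δtt : ℝ, 0 < δtt → δtt ≤ Real.exp (-2) →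
        δt * vecNorm (nonlin u₀) = δtt * vecNorm (comps u₀) →
          vecNorm (comps (u δt)) ≤ vecNorm (comps u₀)

/-- **Step 10 — Theorem 8.1 pp. 145–146: «There exists the solution u⃗ of the equation (8.1) in the
space →TS for any time t ∈ [0, δt]».** For every admissible `ν`, `ε`, ONE admissible step `δt ∈
(0, e^{−2}]` («For example δt = e^{−q₃}», independent of the datum) and EVERY divergence-free `u⃗₀ ∈ →TS`:
a `→TS`-valued, jointly continuous solution of (8.1) on `[0, δt]` exists. Printed proof (p. 146): «Let
us assume that u⃗ ∈ →TS … Owing to all this it is evident that a solution of the equation (8.1) for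
any time t ∈ [0, δt] is u⃗ ∈ →TS. Q.E.D.» — invariance of `→TS` under the right-hand side of (8.2), no
fixed-point, contraction or compactness argument. Typist's flag: suspicious (load-bearing for
existence; the conclusion «`u⃗(t) ∈ →TS`» for generic Schwartz data is itself in doubt — spatial
spreading — and a datum-independent `δt` is a uniform local existence time).
[cite: TsionskiyTsionskiy2025, Thm 8.1 pp. 145–146] -/
def Step_10 : Prop :=
  ∀ ν : ℝ, 0 ≤ ν → ∀ ε : ℝ, 0 < ε → ε ≤ Real.exp (-2) → ∀ δt : ℝ, 0 < δt → δt ≤ Real.exp (-2) →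
    ∀ u₀ : EuclideanSpace ℝ (Fin 3) → EuclideanSpace ℝ (Fin 3), InTS u₀ → NSWave0.IsDivFree u₀ →
      ∃ u : ℝ → EuclideanSpace ℝ (Fin 3) → EuclideanSpace ℝ (Fin 3), IsIntegralSolutionOn ν ε δt u₀ u

/-- **Step 11 — Theorem 8.2 p. 146: «There exists the unique solution u⃗ of the equation (8.1) in the
space →TS for any time t ∈ [0, δt]».** Two `→TS`-valued continuous solutions of (8.1) on `[0, δt]` from
the same datum coincide. Printed proof: «We introduce Δu⃗ = u⃗ − u⃗′ … Obviously Δu⃗₀ = 0 … Further we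
repeat the calculation (7.1)–(7.11) in this case for any time t ∈ [0, δt] and receive an inequality,
analogous (7.11). |Δu⃗| ≤ |Δu⃗₀| = 0 (8.4)». Typist's flag: true as a STATEMENT (classical uniqueness
of smooth solutions with Schwartz slices); the printed proof rests on Step 9 applied to `Δu⃗`, which
does not solve (8.1), under (7.3)–(7.4) with `|Δu⃗₀| = 0` (vacuity note).
[cite: TsionskiyTsionskiy2025, Thm 8.2 (8.3)–(8.5) p. 146] -/
def Step_11 : Prop :=
  ∀ ν : ℝ, 0 ≤ ν → ∀ ε : ℝ, 0 < ε → ε ≤ Real.exp (-2) → ∀ δt : ℝ, 0 < δt → δt ≤ Real.exp (-2) →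
    ∀ u₀ : EuclideanSpace ℝ (Fin 3) → EuclideanSpace ℝ (Fin 3), InTS u₀ → NSWave0.IsDivFree u₀ →
    ∀ u u' : ℝ → EuclideanSpace ℝ (Fin 3) → EuclideanSpace ℝ (Fin 3),
      IsIntegralSolutionOn ν ε δt u₀ u → IsIntegralSolutionOn ν ε δt u₀ u' →
        ∀ t ∈ Icc 0 δt, u t = u' t

/-- **Step 12 — IMPLICIT continuation (p. 146 l. −5 – p. 147 l. 3):** «Further, repeating the arguments
of the Cauchy problem solution for the Navier Stokes equations (7.1)–(8.5) with initial time t = δt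
instead of t = 0 and the initial velocity u⃗|_{t=δt} instead of u⃗₀, we again obtain an estimate of
velocity u⃗ for the next small interval of time δt … and then the solution u⃗ for this interval of time
δt. These arguments and equations ((7.1)–(8.5)) can be repeated arbitrarily long. Availability Δt
leads to the fact that the process … continue for t → ∞.» Typed as the implication the paragraph
asserts between its own objects: IF for one fixed step `δt ∈ (0, e^{−2}]` every divergence-free
`w⃗ ∈ →TS` has a unique (velocity of a) classical solution on `ℝ³ × [0, δt]` with `→TS` slices, THEN every
divergence-free `u⃗₀ ∈ →TS` has a unique classical solution on `ℝ³ × [0, ∞)` with `→TS` slices.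
Typist's flag: true as typed (restart at `kδt` from the slice `u⃗(kδt) ∈ →TS`, translate in time,
glue; smoothness across the junctions from the equation) — an unprinted but classical lemma, named
«implicit» per README convention 4. [cite: TsionskiyTsionskiy2025, §8 pp. 146–147] -/
def Step_12 : Prop :=
  ∀ ν : ℝ, 0 ≤ ν → ∀ δt : ℝ, 0 < δt → δt ≤ Real.exp (-2) →
    (∀ w : EuclideanSpace ℝ (Fin 3) → EuclideanSpace ℝ (Fin 3), InTS w → NSWave0.IsDivFree w →
      (∃ (u : ℝ → EuclideanSpace ℝ (Fin 3) → EuclideanSpace ℝ (Fin 3))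
          (p : ℝ → EuclideanSpace ℝ (Fin 3) → ℝ), LocalSol ν δt w u p) ∧
      (∀ (u u' : ℝ → EuclideanSpace ℝ (Fin 3) → EuclideanSpace ℝ (Fin 3))
          (p p' : ℝ → EuclideanSpace ℝ (Fin 3) → ℝ),
          LocalSol ν δt w u p → LocalSol ν δt w u' p' → ∀ t ∈ Icc 0 δt, u t = u' t)) →
    ∀ u₀ : EuclideanSpace ℝ (Fin 3) → EuclideanSpace ℝ (Fin 3), InTS u₀ → NSWave0.IsDivFree u₀ →
      (∃ (u : ℝ → EuclideanSpace ℝ (Fin 3) → EuclideanSpace ℝ (Fin 3))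
          (p : ℝ → EuclideanSpace ℝ (Fin 3) → ℝ), GlobalSol ν u₀ u p) ∧
      (∀ (u u' : ℝ → EuclideanSpace ℝ (Fin 3) → EuclideanSpace ℝ (Fin 3))
          (p p' : ℝ → EuclideanSpace ℝ (Fin 3) → ℝ),
          GlobalSol ν u₀ u p → GlobalSol ν u₀ u' p' → ∀ t ∈ Ici 0, u t = u' t)

/-- **Step 13 — the energy bound (8.7) p. 147 from the cited external inequality:** «Then, using the
inequality ‖u⃗‖_{L₂} ≤ ‖u⃗₀‖_{L₂} from [13], [12] [Ladyzhenskaya 1969; Kiselev–Ladyzhenskaya 1957], we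
have ∫_{R³} |u⃗_∞(x,t)|² dx < C, ∀ t ≥ 0 (8.7)»: for the global classical solution with `→TS` slices
from a divergence-free `u⃗₀ ∈ →TS`, `∫ |u⃗(x,t)|² dx ≤ ∫ |u⃗₀(x)|² dx` for every `t ≥ 0` (lower Lebesgue
integrals; the right-hand side is finite for Schwartz data). Typist's flag: classical (energy
inequality for smooth, rapidly decreasing solutions; at `ν = 0` the energy equality).
[cite: TsionskiyTsionskiy2025, (8.7) p. 147] -/
def Step_13 : Prop :=
  ∀ ν : ℝ, 0 ≤ ν →
    ∀ u₀ : EuclideanSpace ℝ (Fin 3) → EuclideanSpace ℝ (Fin 3), InTS u₀ → NSWave0.IsDivFree u₀ →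
    ∀ (u : ℝ → EuclideanSpace ℝ (Fin 3) → EuclideanSpace ℝ (Fin 3))
      (p : ℝ → EuclideanSpace ℝ (Fin 3) → ℝ), GlobalSol ν u₀ u p →
        ∀ t : ℝ, 0 ≤ t → ∫⁻ x, ‖u t x‖ₑ ^ 2 ≤ ∫⁻ x, ‖u₀ x‖ₑ ^ 2

/-! ## Compositions (kernel) -/

/-- (7.9) ⇒ (7.10) is algebra: Step 8 follows from Step 7 (p. 145). [cite: TsionskiyTsionskiy2025, (7.9)–(7.10) pp. 144–145] -/
theorem step8_of_step7 (h7 : Step_7) : Step_8 := by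
  intro ν hν ε hε hε' δt hδ hδ' u₀ hu₀ hdiv u hu h73 h74 δtt _ _ hrel
  have h := h7 ν hν ε hε hε' δt hδ hδ' u₀ hu₀ hdiv u hu h73 h74
  calc vecNorm (comps (u δt))
      ≤ δt * vecNorm (nonlin u₀) + ε * vecNorm (comps u₀) + vecNorm (comps u₀) := h
    _ = (δtt + ε + 1) * vecNorm (comps u₀) := by rw [hrel]; ring

/-- **The local Cauchy theory in `→TS` on one step**, assembled as on p. 146 from the STATEMENTS of
Thm 8.1 (Step 10), Thm 8.2 (Step 11) and the §5 equivalence (Step 1): for every divergence-free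
`w⃗ ∈ →TS`, existence and uniqueness of a classical solution on `[0, δt]` with `→TS` slices.
[cite: TsionskiyTsionskiy2025, §8 pp. 145–146] -/
theorem localCauchy_of_steps (h1 : Step_1) (h10 : Step_10) (h11 : Step_11) {ν : ℝ} (hν : 0 ≤ ν)
    {ε : ℝ} (hε : 0 < ε) (hε' : ε ≤ Real.exp (-2)) {δt : ℝ} (hδ : 0 < δt) (hδ' : δt ≤ Real.exp (-2)) :
    ∀ w : EuclideanSpace ℝ (Fin 3) → EuclideanSpace ℝ (Fin 3), InTS w → NSWave0.IsDivFree w →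
      (∃ (u : ℝ → EuclideanSpace ℝ (Fin 3) → EuclideanSpace ℝ (Fin 3))
          (p : ℝ → EuclideanSpace ℝ (Fin 3) → ℝ), LocalSol ν δt w u p) ∧
      (∀ (u u' : ℝ → EuclideanSpace ℝ (Fin 3) → EuclideanSpace ℝ (Fin 3))
          (p p' : ℝ → EuclideanSpace ℝ (Fin 3) → ℝ),
          LocalSol ν δt w u p → LocalSol ν δt w u' p' → ∀ t ∈ Icc 0 δt, u t = u' t) := by
  intro w hw hdiv
  refine ⟨?_, ?_⟩
  · obtain ⟨u, hsl, hcont, heq⟩ := h10 ν hν ε hε hε' δt hδ hδ' w hw hdiv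
    obtain ⟨p, hcl, h0⟩ := (h1 ν hν ε hε hε' δt hδ w hw hdiv u hsl hcont).mpr heq
    exact ⟨u, p, hcl, h0, hsl⟩
  · intro u u' p p' hu hu' t ht
    have hI : IsIntegralSolutionOn ν ε δt w u :=
      ⟨hu.2.2, hu.1.smooth_velocity.continuousOn,
        (h1 ν hν ε hε hε' δt hδ w hw hdiv u hu.2.2 hu.1.smooth_velocity.continuousOn).mp
          ⟨p, hu.1, hu.2.1⟩⟩
    have hI' : IsIntegralSolutionOn ν ε δt w u' :=
      ⟨hu'.2.2, hu'.1.smooth_velocity.continuousOn,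
        (h1 ν hν ε hε hε' δt hδ w hw hdiv u' hu'.2.2 hu'.1.smooth_velocity.continuousOn).mp
          ⟨p', hu'.1, hu'.2.1⟩⟩
    exact h11 ν hν ε hε hε' δt hδ hδ' w hw hdiv u u' hI hI' t ht

/-- **The global theory in `→TS`** for a fixed viscosity `ν ≥ 0`, from Steps 1, 10, 11, 12 (with the
admissible choices `ε = δt = e^{−2}`): existence and uniqueness of a classical solution on
`ℝ³ × [0, ∞)` with `→TS` slices from every divergence-free `u⃗₀ ∈ →TS` — the content of Remark 8.3
before (8.7). [cite: TsionskiyTsionskiy2025, Remark 8.3 p. 147] -/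
theorem globalSol_of_steps (h1 : Step_1) (h10 : Step_10) (h11 : Step_11) (h12 : Step_12) {ν : ℝ}
    (hν : 0 ≤ ν) :
    ∀ u₀ : EuclideanSpace ℝ (Fin 3) → EuclideanSpace ℝ (Fin 3), InTS u₀ → NSWave0.IsDivFree u₀ →
      (∃ (u : ℝ → EuclideanSpace ℝ (Fin 3) → EuclideanSpace ℝ (Fin 3))
          (p : ℝ → EuclideanSpace ℝ (Fin 3) → ℝ), GlobalSol ν u₀ u p) ∧
      (∀ (u u' : ℝ → EuclideanSpace ℝ (Fin 3) → EuclideanSpace ℝ (Fin 3))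
          (p p' : ℝ → EuclideanSpace ℝ (Fin 3) → ℝ),
          GlobalSol ν u₀ u p → GlobalSol ν u₀ u' p' → ∀ t ∈ Ici 0, u t = u' t) :=
  h12 ν hν (Real.exp (-2)) (Real.exp_pos _) le_rfl
    (localCauchy_of_steps h1 h10 h11 hν (Real.exp_pos _) le_rfl (Real.exp_pos _) le_rfl)

/-- A smooth wave-0 solution of (2.1)–(2.3) with rapidly decreasing slices is a `GlobalSol` (the
object of Remark 8.3; tree bridge `isNavierStokesSolution_and_smooth_iff`).
[cite: TsionskiyTsionskiy2025, Remark 8.3 p. 147] -/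
theorem globalSol_of_wave0 {ν : ℝ} {u₀ : EuclideanSpace ℝ (Fin 3) → EuclideanSpace ℝ (Fin 3)}
    {u : ℝ → EuclideanSpace ℝ (Fin 3) → EuclideanSpace ℝ (Fin 3)}
    {p : ℝ → EuclideanSpace ℝ (Fin 3) → ℝ}
    (h : IsSmoothOnHalfSpace u ∧ IsSmoothOnHalfSpace p ∧ IsNavierStokesSolution ν 0 u₀ u p ∧
      ∀ t : ℝ, 0 ≤ t → HasRapidSpatialDecay (u t)) :
    GlobalSol ν u₀ u p := by
  obtain ⟨hsu, hsp, hns, hdec⟩ := h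
  obtain ⟨hcl, h0⟩ := isNavierStokesSolution_and_smooth_iff.mp ⟨hns, hsu, hsp⟩
  exact ⟨hcl, h0, fun t ht => ⟨hcl.contDiff_velocity ht, hdec t ht⟩⟩

/-- **KERNEL COMPOSITION.** The claimed theorem (Remark 8.3 (8.6)–(8.7) with uniqueness) follows from
the thirteen Steps; the proof consumes Steps 1, 10, 11, 12, 13 (module docstring, COMPOSITION).
[cite: TsionskiyTsionskiy2025, Remark 8.3 p. 147] -/
theorem claim_of_steps : Step_1 → Step_2 → Step_3 → Step_4 → Step_5 → Step_6 → Step_7 → Step_8 →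
    Step_9 → Step_10 → Step_11 → Step_12 → Step_13 → ClaimedTheorem := by
  intro h1 _ _ _ _ _ _ _ _ h10 h11 h12 h13
  refine ⟨?_, ?_⟩
  · intro ν hν u₀ hu₀ hdiv hdata
    have hTS : InTS u₀ := ⟨hu₀, hdata⟩
    obtain ⟨⟨u, p, hG⟩, -⟩ := globalSol_of_steps h1 h10 h11 h12 hν.le u₀ hTS hdiv
    obtain ⟨hns, hsu, hsp⟩ := isNavierStokesSolution_and_smooth_iff.mpr ⟨hG.1, hG.2.1⟩
    have hfin : ∫⁻ x, ‖u₀ x‖ₑ ^ 2 < ⊤ := by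
      have h0 := hdata.lintegral_enorm_iteratedFDeriv_sq_lt_top (μ := volume) 0
      refine lt_of_le_of_lt (le_of_eq ?_) h0
      exact lintegral_congr fun x => by rw [← ofReal_norm, ← ofReal_norm, norm_iteratedFDeriv_zero]
    exact ⟨u, p, hsu, hsp, hns, ∫⁻ x, ‖u₀ x‖ₑ ^ 2, hfin,
      fun t ht => h13 ν hν.le u₀ hTS hdiv u p hG t ht⟩
  · intro ν hν u₀ hu₀ hdiv hdata u u' p p' hu hu' t ht
    have hTS : InTS u₀ := ⟨hu₀, hdata⟩
    exact (globalSol_of_steps h1 h10 h11 h12 hν.le u₀ hTS hdiv).2 u u' p p'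
      (globalSol_of_wave0 hu) (globalSol_of_wave0 hu') t ht

/-- **KERNEL COMPOSITION, Euler sentence** (p. 147): the `ν = 0` instances of Steps 1, 10, 11, 12
give `ClaimedEuler`. [cite: TsionskiyTsionskiy2025, Remark 8.3 p. 147] -/
theorem euler_of_steps (h1 : Step_1) (h10 : Step_10) (h11 : Step_11) (h12 : Step_12) :
    ClaimedEuler := by
  refine ⟨?_, ?_⟩
  · intro u₀ hu₀ hdiv hdata
    obtain ⟨⟨u, p, hG⟩, -⟩ := globalSol_of_steps h1 h10 h11 h12 le_rfl u₀ ⟨hu₀, hdata⟩ hdiv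
    obtain ⟨hns, hsu, hsp⟩ := isNavierStokesSolution_and_smooth_iff.mpr ⟨hG.1, hG.2.1⟩
    exact ⟨u, p, hsu, hsp, hns⟩
  · intro u₀ hu₀ hdiv hdata u u' p p' hu hu' t ht
    exact (globalSol_of_steps h1 h10 h11 h12 le_rfl u₀ ⟨hu₀, hdata⟩ hdiv).2 u u' p p'
      (globalSol_of_wave0 hu) (globalSol_of_wave0 hu') t ht

/-! ## The printed properties of the three concrete multipliers hold — `Eq614`, `Eq628`, `Eq657`
(D-0026 in-file discharges of the «(true)» support decls; the verdict of record #9 and every locator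
are untouched; `Eq614` is also kernel-true Summits-side as `…Theorems.Tsionskiy2025.eq614_holds`,
SoloRefuteTsionskiy2025Abs.lean, not importable here) -/

/-- The cutoff (3.11) is Mathlib's `expNegInvGlue` at `‖γ‖²/ε³` (for `ε > 0`). [folklore] -/
private theorem cutoff_eq_expNegInvGlue {ε : ℝ} (hε : 0 < ε) (γ : EuclideanSpace ℝ (Fin 3)) :
    cutoff ε γ = expNegInvGlue (‖γ‖ ^ 2 / ε ^ 3) := by
  by_cases h : γ = 0
  · subst h
    simp [cutoff, expNegInvGlue.zero_of_nonpos le_rfl]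
  · have hx : 0 < ‖γ‖ ^ 2 / ε ^ 3 := by
      have : 0 < ‖γ‖ := norm_pos_iff.mpr h
      positivity
    rw [cutoff, if_neg h, expNegInvGlue, if_neg (not_le.mpr hx), inv_div]
    congr 1
    ring

/-- The cutoff is continuous (extended by `0` at `γ = 0`; (3.12) p. 122). [folklore] -/
private theorem continuous_cutoff {ε : ℝ} (hε : 0 < ε) : Continuous (cutoff ε) := by
  have h : cutoff ε = fun γ => expNegInvGlue (‖γ‖ ^ 2 / ε ^ 3) :=
    funext (cutoff_eq_expNegInvGlue hε)
  rw [h]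
  exact expNegInvGlue.contDiff (n := 0) |>.continuous.comp
    ((continuous_norm.pow 2).div_const _)

/-- `0 ≤ δ(γ)`. [folklore] -/
private theorem cutoff_nonneg (ε : ℝ) (γ : EuclideanSpace ℝ (Fin 3)) : 0 ≤ cutoff ε γ := by
  unfold cutoff
  split_ifs
  · exact le_rfl
  · exact Real.exp_nonneg _

/-- `δ(γ) < 1` (for `ε > 0`). [folklore] -/
private theorem cutoff_lt_one {ε : ℝ} (hε : 0 < ε) (γ : EuclideanSpace ℝ (Fin 3)) :
    cutoff ε γ < 1 := by
  unfold cutoff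
  split_ifs with h
  · exact zero_lt_one
  · have : 0 < ‖γ‖ := norm_pos_iff.mpr h
    refine Real.exp_lt_one_iff.mpr ?_
    have : 0 < ε ^ 3 / ‖γ‖ ^ 2 := by positivity
    rw [neg_div]
    linarith

/-- `δ` is even. [folklore] -/
private theorem cutoff_neg (ε : ℝ) (γ : EuclideanSpace ℝ (Fin 3)) : cutoff ε (-γ) = cutoff ε γ := by
  simp [cutoff, norm_neg]

/-- Off the ball `|γ| < ε`: `1 − δ(γ) ≤ ε³/|γ|² ≤ ε` ((6.28)–(6.29) p. 137). [folklore] -/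
private theorem one_sub_cutoff_le {ε : ℝ} (hε : 0 < ε) {γ : EuclideanSpace ℝ (Fin 3)}
    (hγ : ε ^ 2 ≤ ‖γ‖ ^ 2) : 1 - cutoff ε γ ≤ ε := by
  have hγpos : 0 < ‖γ‖ ^ 2 := lt_of_lt_of_le (by positivity) hγ
  have hne : γ ≠ 0 := by
    intro h; rw [h, norm_zero] at hγpos; simp at hγpos
  rw [cutoff, if_neg hne]
  have h1 : -(ε ^ 3 / ‖γ‖ ^ 2) + 1 ≤ Real.exp (-(ε ^ 3) / ‖γ‖ ^ 2) := by
    rw [neg_div]; exact Real.add_one_le_exp _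
  have h2 : ε ^ 3 / ‖γ‖ ^ 2 ≤ ε ^ 3 / ε ^ 2 :=
    div_le_div_of_nonneg_left (by positivity) (by positivity) hγ
  have h3 : ε ^ 3 / ε ^ 2 = ε := by field_simp
  linarith

/-- `0 ≤ A < 1` for the multiplier of `B` ((6.14); `ν ≥ 0`, `t ≥ 0`, `ε > 0`). [folklore] -/
private theorem symbB_bounds {ν t ε : ℝ} (hν : 0 ≤ ν) (ht : 0 ≤ t) (hε : 0 < ε)
    (γ : EuclideanSpace ℝ (Fin 3)) : 0 ≤ symbB ν t ε γ ∧ symbB ν t ε γ < 1 := by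
  unfold symbB
  have hc0 := cutoff_nonneg ε γ
  have hc1 := cutoff_lt_one hε γ
  have he : Real.exp (-(ν * ‖γ‖ ^ 2 * t)) ≤ 1 := by
    rw [Real.exp_le_one_iff]
    have : 0 ≤ ν * ‖γ‖ ^ 2 * t := by positivity
    linarith
  refine ⟨mul_nonneg (Real.exp_nonneg _) hc0, ?_⟩
  calc Real.exp (-(ν * ‖γ‖ ^ 2 * t)) * cutoff ε γ ≤ 1 * cutoff ε γ :=
        mul_le_mul_of_nonneg_right he hc0
    _ < 1 := by rw [one_mul]; exact hc1

/-- The multiplier of `B` is continuous (`ε > 0`). [folklore] -/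
private theorem continuous_symbB (ν t : ℝ) {ε : ℝ} (hε : 0 < ε) : Continuous (symbB ν t ε) := by
  unfold symbB
  exact (((continuous_const.mul (continuous_norm.pow 2)).mul continuous_const).neg.rexp).mul
    (continuous_cutoff hε)

/-- The multiplier of `B` is even. [folklore] -/
private theorem symbB_neg (ν t ε : ℝ) (γ : EuclideanSpace ℝ (Fin 3)) :
    symbB ν t ε (-γ) = symbB ν t ε γ := by
  simp [symbB, norm_neg, cutoff_neg]

/-- **`Eq614` holds** — the printed properties (6.8)/(6.14) p. 134–135 of the multiplier of `B`:
continuous, even, `0 ≤ A < 1`. (Summits-side twin: `…Theorems.Tsionskiy2025.eq614_holds`.)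
[cite: TsionskiyTsionskiy2025, (6.8) p. 134, (6.14) p. 135] -/
theorem eq614_holds : Eq614 := by
  intro ν hν ε hε _ t ht _
  exact ⟨continuous_symbB ν t hε, fun γ => symbB_neg ν t ε γ,
    fun γ => symbB_bounds hν ht.le hε γ⟩

/-- `Eq614` — `_holds` alias of `eq614_holds` above under the fact's exact name (appended
2026-08-28, D-0026 bookkeeping: the proof term is the existing theorem of this file; no statement,
definition or attribute is edited; no new named fact; the ledger's debt table listed the fact
unproved). [cite: TsionskiyTsionskiy2025, (6.8) p. 134, (6.14) p. 135] -/
theorem _root_.Literature.Claims.NS.Tsionskiy2025.Eq614_holds : Eq614 :=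
  _root_.Literature.Claims.NS.Tsionskiy2025.eq614_holds

/-- **`Eq628` holds** — the printed properties (6.22) p. 136, (6.28)–(6.29) p. 137 of the multiplier
of `E`, `A = 1 − δ(γ)`: continuous, even, `0 < A ≤ 1`, and `A ≤ ε` wherever `|γ|² ≥ ε²`
(`1 − e^{−x} ≤ x` with `x = ε³/|γ|² ≤ ε`).
[cite: TsionskiyTsionskiy2025, (6.22) p. 136, (6.28)–(6.29) p. 137] -/
theorem eq628_holds : Eq628 := by
  intro ε hε _
  refine ⟨continuous_const.sub (continuous_cutoff hε), fun γ => by simp [symbE, cutoff_neg],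
    fun γ => ⟨?_, ?_⟩, fun γ hγ => ?_⟩
  · have := cutoff_lt_one hε γ
    unfold symbE; linarith
  · have := cutoff_nonneg ε γ
    unfold symbE; linarith
  · unfold symbE
    exact one_sub_cutoff_le hε hγ

/-- `Eq628` — `_holds` alias of `eq628_holds` above under the fact's exact name (appended
2026-08-28, D-0026 bookkeeping: the proof term is the existing theorem of this file; no statement,
definition or attribute is edited; no new named fact; the ledger's debt table listed the fact
unproved). [cite: TsionskiyTsionskiy2025, (6.22) p. 136, (6.28)–(6.29) p. 137] -/
theorem _root_.Literature.Claims.NS.Tsionskiy2025.Eq628_holds : Eq628 :=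
  _root_.Literature.Claims.NS.Tsionskiy2025.eq628_holds

/-- The diagonal Leray multiplier `χ_ii = (|γ|² − γᵢ²)/|γ|²` takes values in `[0, 1]`. [folklore] -/
private theorem leray_diag_bounds (i : Fin 3) (γ : EuclideanSpace ℝ (Fin 3)) :
    0 ≤ leray i i γ ∧ leray i i γ ≤ 1 := by
  unfold leray
  simp only [if_true]
  split_ifs with h
  · norm_num
  · have hn : 0 < ‖γ‖ ^ 2 := by
      have : 0 < ‖γ‖ := norm_pos_iff.mpr h
      positivity
    have hsq : γ i * γ i ≤ ‖γ‖ ^ 2 := by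
      have h1 : ‖γ i‖ ^ 2 ≤ ‖γ‖ ^ 2 := by
        rw [EuclideanSpace.norm_eq γ, Real.sq_sqrt (Finset.sum_nonneg fun j _ => by positivity)]
        exact Finset.single_le_sum (f := fun j => ‖γ j‖ ^ 2) (fun j _ => by positivity)
          (Finset.mem_univ i)
      rw [Real.norm_eq_abs, sq_abs] at h1
      nlinarith
    have h0 : 0 ≤ γ i * γ i := mul_self_nonneg _
    constructor
    · rw [sub_nonneg, div_le_one hn]; exact hsq
    · have : 0 ≤ γ i * γ i / ‖γ‖ ^ 2 := div_nonneg h0 hn.le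
      linarith

/-- The diagonal Leray multiplier is continuous away from the origin. [folklore] -/
private theorem continuousAt_leray_diag (i : Fin 3) {γ₀ : EuclideanSpace ℝ (Fin 3)} (h0 : γ₀ ≠ 0) :
    ContinuousAt (leray i i) γ₀ := by
  have hne : ‖γ₀‖ ^ 2 ≠ 0 := pow_ne_zero 2 (norm_ne_zero_iff.mpr h0)
  have hproj : Continuous fun γ : EuclideanSpace ℝ (Fin 3) => γ i :=
    (EuclideanSpace.proj i).continuous
  have hc : ContinuousAt (fun γ : EuclideanSpace ℝ (Fin 3) => 1 - γ i * γ i / ‖γ‖ ^ 2) γ₀ :=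
    continuousAt_const.sub
      (((hproj.mul hproj).continuousAt).div ((continuous_norm.pow 2).continuousAt) hne)
  refine hc.congr ?_
  filter_upwards [isOpen_ne.mem_nhds h0] with γ hγ
  simp [leray, if_neg hγ]

/-- The diagonal multiplier of `S̿ᵗ` is `χ_ii` times the multiplier of `B` at lag `s`. [folklore] -/
private theorem symbS_diag_eq (ν s ε : ℝ) (i : Fin 3) (γ : EuclideanSpace ℝ (Fin 3)) :
    symbS ν s ε i i γ = leray i i γ * symbB ν s ε γ := by
  unfold symbS symbB
  ring

/-- **`Eq657` holds** — the printed properties (6.47) p. 141, (6.57) p. 143 of the diagonal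
multipliers of `S̿ᵗ`, `A_ii = χ_ii e^{−ν|γ|²(t−t*)} δ(γ)`: continuous (at `γ = 0` by the squeeze
`0 ≤ A_ii ≤ A_B → 0`, `χ_ii` being bounded but not continuous there), even, `0 ≤ A_ii < 1`.
[cite: TsionskiyTsionskiy2025, (6.47) p. 141, (6.57) p. 143] -/
theorem eq657_holds : Eq657 := by
  intro ν hν ε hε _ t _ _ tstar _ hts i
  have hs : 0 ≤ t - tstar := by linarith
  have hfun : symbS ν (t - tstar) ε i i = fun γ => leray i i γ * symbB ν (t - tstar) ε γ :=
    funext (symbS_diag_eq ν (t - tstar) ε i)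
  -- bounds
  have hb : ∀ γ, 0 ≤ symbS ν (t - tstar) ε i i γ ∧ symbS ν (t - tstar) ε i i γ < 1 := by
    intro γ
    rw [symbS_diag_eq]
    obtain ⟨hl0, hl1⟩ := leray_diag_bounds i γ
    obtain ⟨hB0, hB1⟩ := symbB_bounds hν hs hε γ
    refine ⟨mul_nonneg hl0 hB0, ?_⟩
    calc leray i i γ * symbB ν (t - tstar) ε γ ≤ 1 * symbB ν (t - tstar) ε γ :=
          mul_le_mul_of_nonneg_right hl1 hB0
      _ < 1 := by rw [one_mul]; exact hB1
  refine ⟨?_, fun γ => ?_, hb⟩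
  · -- continuity
    refine continuous_iff_continuousAt.mpr fun γ₀ => ?_
    by_cases h0 : γ₀ = 0
    · subst h0
      have hval : symbS ν (t - tstar) ε i i 0 = 0 := by
        simp [symbS, cutoff]
      have hup : Tendsto (symbB ν (t - tstar) ε) (𝓝 0) (𝓝 0) := by
        have h := (continuous_symbB ν (t - tstar) hε).tendsto (0 : EuclideanSpace ℝ (Fin 3))
        have h0' : symbB ν (t - tstar) ε 0 = 0 := by simp [symbB, cutoff]
        rwa [h0'] at h
      have h : Tendsto (symbS ν (t - tstar) ε i i) (𝓝 0) (𝓝 0) :=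
        tendsto_of_tendsto_of_tendsto_of_le_of_le tendsto_const_nhds hup (fun γ => (hb γ).1)
          (fun γ => by
            rw [symbS_diag_eq]
            obtain ⟨hl0, hl1⟩ := leray_diag_bounds i γ
            have hB0 := (symbB_bounds hν hs hε γ).1
            calc leray i i γ * symbB ν (t - tstar) ε γ ≤ 1 * symbB ν (t - tstar) ε γ :=
                  mul_le_mul_of_nonneg_right hl1 hB0
              _ = symbB ν (t - tstar) ε γ := one_mul _)
      rw [ContinuousAt, hval]; exact h
    · rw [hfun]
      exact (continuousAt_leray_diag i h0).mul (continuous_symbB ν (t - tstar) hε).continuousAt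
  · -- evenness
    rw [symbS_diag_eq, symbS_diag_eq, symbB_neg]
    congr 1
    simp [leray, neg_eq_zero]

/-- `Eq657` — `_holds` alias of `eq657_holds` above under the fact's exact name (appended
2026-08-28, D-0026 bookkeeping: the proof term is the existing theorem of this file; no statement,
definition or attribute is edited; no new named fact; the ledger's debt table listed the fact
unproved). [cite: TsionskiyTsionskiy2025, (6.47) p. 141, (6.57) p. 143] -/
theorem _root_.Literature.Claims.NS.Tsionskiy2025.Eq657_holds : Eq657 :=
  _root_.Literature.Claims.NS.Tsionskiy2025.eq657_holds

end

end Literature.Claims.NS.Tsionskiy2025
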